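import Literature.MathematicalPhysics.QuantumFieldTheory.Balaban1983to89.TreeLengthCubeSystem
import Literature.MathematicalPhysics.QuantumFieldTheory.Balaban1983to89.B13Ineq232TreeLength

/-!
# `Balaban1983to89.B14Eq344PolymerRatio` — T. Bałaban, *Convergent renormalization expansions for lattice gauge
theories*, Commun. Math. Phys. **119** (1988) 243–285, doi:10.1007/bf01217741 [Balaban1988Convergent]:
the exponentiated cluster expansion of the expectation values, **(3.44)–(3.46)** pp. 277–278 — the separation of the
marked polymer `Z₀ ∋ b`, the exponentiation (3.45) and the resummation (3.46) — PROVED for the abstract hard-core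
polymer gas under the Kotecký–Preiss condition, with the window-model instance; v1.1: the Mayer resummation (3.47);
v1.2: the kernel bound on the (3.47) terms and their `Λ_{k+1}`-independence (p. 278); v1.3: the bound instantiated for
the window model (geometric inputs discharged by the tree-length library)

HONEST FRAMING (cell `lit-balaban`, verbatim): statement-level skeleton of published theorems with citation tags; proofs where landed; nothing here is a claim about the Yang–Mills mass gap.

PDF held: `paper:balaban1988-cmp119-convergent-renormalization` (journal page = PDF page + 242); pp. 277–278 read
from the OCR text (`lit read … --pages 35-36`) AND as images from
`run/shared/lean/pub/pub-balaban/b2b-balaban-ref1/pages/1988-cmp119-convergent-renormalization/…-p035-x2.png`,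
`…-p036-x2.png`.

CITATION HEADER (verbatim).  p. 277 [PDF 35]: *"The normalization factor in it, which is the integral in the logarithm
on the right-hand side of (3.28), is expanded in exactly the same way as in Sect. 7 [I]. The differences, like the
restriction of the integration to Λ_{k+1}, or the larger class of localization domains, do not matter, and the factor
is represented as exp Ẽ^{(k+1)}(Λ_{k+1}). The expression Ẽ^{(k+1)}(Λ_{k+1}) in the exponential is given by (I.7.12),
with terms given by (I.7.13), but with the localization domains Z_i ∈ 𝐃_k, X ∈ 𝐃_{k+1} having nonempty intersections
with Λ_{k+1}. … We obtain*  `[the nominator of the expectation value in (3.37)] = Σ_{{Z₀,…,Z_n}} H′(Z₀)·…·H(Z_n),`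
(3.44) *where the localization domains Z₀,…,Z_n satisfy all the conditions described in Sect. 7 [I] in connection
with the formula (7.11), and the above conditions too. In addition the domain Z₀ contains the bond b (or the point z).
We can have n = 0, for n > 0 the factors H(Z_i) are the same as in the expansion of the denominator. The factor H′(Z₀)
is different"*.  p. 278 [PDF 36]: *"In the sum (3.44) we separate the summation over Z₀, and for a fixed Z₀ we
consider the remaining sum over {Z₁,…,Z_n}. It has the form (I.7.11), with the additional condition that the domains
Z_i do not intersect Z₀ along a cube, or a wall of a cube. This condition can be formulated as Z_i ⊂ Z̄₀ᶜ, where Z̄₀ᶜ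
is the union of all cubes from π_k, such that they do not intersect Z₀, or intersect it along a two-dimensional edge
at most. The sum is exponentiated, and the exponent is represented by (I.7.12), with the additional restriction on the
polymers Z_i. We denote the exponent by Ẽ^{(k+1)}(Λ_{k+1}, Z̄₀ᶜ), and we have*
  `[the expectation value in (3.37)] = Σ_{Z₀⊃b} H′(Z₀) exp[Ẽ^{(k+1)}(Λ_{k+1}, Z̄₀ᶜ) − Ẽ^{(k+1)}(Λ_{k+1})].`  (3.45)
*The difference in the exponential has the representation (I.7.12) with (Z₁,…,Z_n) satisfying the additonal condition
that at least one of the localization domains intersects Z₀ along a three-dimensional wall at least. Resumming the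
terms of this representation according to (I.7.13), we obtain*
  `[the expectation value in (3.37)] = Σ_{Z₀⊃b} H′(Z₀) exp[−Σ_Y Ẽ^{(k+1)}(Λ_{k+1}, Y)].`  (3.46)
*The sum in the exponential is over the localization domains Y satisfying both conditions relative to Λ_{k+1}, Z₀."*
Here (I.7.11)–(I.7.13) = the polymer expansion, its exponentiation and its localized resummation, in the tree
[Balaban1988RG2Cluster] (2.11)–(2.13) (cell transcript note T11 of `lit-balaban-r11/ROWS-B14.md`), typed as
`Literature.Probability.LatticeModels.polymerPartitionFunction` (Ξ), `polymerLogZ` (the Kotecký–Preiss logarithm,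
[KoteckyPreiss1986] (2)) and `B13Resummation.locE` (E(X) = Σ over the clusters with support X of the truncated
functionals `truncatedWeight`).

WHAT IS REPRODUCED (unit `lit-balaban-p25`, generation 2 of the Phase-2 proof seat p25; SKELETON row
`B14.Eq3.44-3.47`, members (3.44)–(3.46) — recorded «absent» in `lit-balaban-r11/ROWS-B14.md`; the decl of record
`B9Locality.locClass/resum` concerns (3.47) only; HOME `run/shared/lean/pub/lit-balaban/lit-balaban-p25/`).
Over the tree's ABSTRACT hard-core polymer gas (polymers `P`, incompatibility `inc` = «intersect along a cube, or a
wall of a cube», activities `H` = the factors of the denominator, `H′` = the marked factor, `Λ` = the localization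
domains meeting `Λ_{k+1}`, `D` = the domains containing the bond `b`):
(A) **(3.44)** `num344 inc H′ H Λ D := Σ_{X ⊆ Λ compatible} Σ_{Z₀ ∈ X ∩ D} H′(Z₀) Π_{Z ∈ X∖{Z₀}} H(Z)` (a compatible
family contains at most one domain containing `b`: `card_inter_le_one`); `Z̄₀ᶜ` ↦ `compatVol inc Λ Z₀` (the domains
of `Λ` compatible with `Z₀`); **the separation of p. 278 PROVED**: `num344 = Σ_{Z₀ ∈ D} H′(Z₀) · Ξ(Z̄₀ᶜ)`
(`num344_eq_sum`, through the bijection `{Z₀,Z₁,…,Z_n} ↦ {Z₁,…,Z_n}` of `sum_filter_mem_prod_erase`);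
(B) **(3.45) PROVED** under the Kotecký–Preiss condition for the denominator activities on `Λ` (*"The sum is
exponentiated"*: the tree's `exp_polymerLogZ_of_kp`, [KoteckyPreiss1986] Theorem): the denominator is
`exp Ẽ(Λ)` (`denominator_eq_exp`) and `num344 / Ξ(Λ) = Σ_{Z₀∈D} H′(Z₀) exp[Ẽ(Λ, Z̄₀ᶜ) − Ẽ(Λ)]` (`eq345`) with
`Ẽ(Λ, Z̄₀ᶜ) = polymerLogZ inc H (compatVol inc Λ Z₀)`, `Ẽ(Λ) = polymerLogZ inc H Λ`;
(C) *"The difference in the exponential has the representation (I.7.12) with … at least one of the localization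
domains intersects Z₀"*: `Ẽ(Λ, Z̄₀ᶜ) − Ẽ(Λ) = −Σ_{C ⊆ Λ, some Z ∈ C incompatible with Z₀} Φᵀ(C)`
(`polymerLogZ_compatVol_sub`, unconditional — [KoteckyPreiss1986] (2) is Möbius inversion), and **(3.46) PROVED**:
with `Ẽ(Λ, Y) := Σ_{C ⊆ Λ, ⋃_{Z∈C} cubes Z = Y} Φᵀ(C)` (`Etilde`; = `B13Resummation.locE` when `Λ` is everything,
`Etilde_univ`) and footprint-local incompatibility (`inc Z₀ Z ↔` some cube of `Z` touches `Z₀`),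
`num344 / Ξ(Λ) = Σ_{Z₀∈D} H′(Z₀) exp[−Σ_{Y touching Z₀} Ẽ(Λ, Y)]` (`eq346`, via the resummation by support
`sum_touching_eq_sum_Etilde`);
(D) the WINDOW-MODEL INSTANCE (`TreeLengthCubeSystem.Dom B`, `Touch B`, footprints `cellsOf`; the polymer gas of
[Balaban1988RG2Cluster] (2.11) as constructed in `TreeLengthCubeSystem.geometry`): `eq346_window`, with `D` = the
domains containing a given cube (`domsWith`, a clique: `touch_of_mem_domsWith`) and «Y touches Z₀» =
`TouchesCells` (*"intersects Z₀ along a three-dimensional wall at least"*, or along a cube);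
(E)–(F) (v1.1, append-only) **(3.47)** as an exact finite identity: the Mayer re-expansion of the exponential of (3.46)
(`exp_neg_sum_eq_sum_powerset_prod`, the combinatorial identity of (I.7.1)) resummed over the total support
`X = Z₀ ∪ ⋃Y` — `Σ_{Z₀⊃b} H′(Z₀) exp[−Σ_{Y} Ẽ(Λ,Y)] = Σ_{X ⊃ b} E₀(Λ, X, b)` (`eq347`, with `E0`, `supports347`,
`exists_subset_of_mem_supports347` = «X ⊃ b»), and the window-model chain (3.44)–(3.47) `eq347_window`.
(G) (v1.2, append-only) the printed BOUND on the (3.47) terms (*"satisfy the bounds (2.42), with the constant B₀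
replaced by O(p₀³(g_k))"*) as a KERNEL THEOREM `norm_E0_le`: from decay of the marked activities, smallness-with-decay
of the exponents `Ẽ(Λ,Y)` (for `locE`: `B13Resummation.norm_locE_le`), (1.26)-type summability of the touching
supports and of the marked domains, the volume bound and tree-length subadditivity — all explicit hypotheses —
`‖E₀(X)‖ ≤ A′e^{2εe^{κc}Kc₁}K_D·e^{−κd(X)}`;
(H) (v1.2) the `Λ_{k+1}`-INDEPENDENCE remark of p. 278 (*"the terms E₀^{(k+1)}(Λ_{k+1}, X, z) of this representation,
for X ⊂ Λ_{k+1}, do not depend on Λ_{k+1} and coincide with the corresponding terms arising from the expressions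
defined on the whole lattice"*) PROVED for the polymer gas: `E0_restrict` / `E0_local` (`E₀(X)` only sees the marked
domains and supports inside `X`), `Etilde_local`, `E0_eq_of_inside_eq` (two catalogues with the same domains inside
`X` give the same `E₀(X)`), `E0_eq_wholeLattice` (= the term built from the whole catalogue and `locE` = (I.7.13));
(I) (v1.3) the bound of (G) INSTANTIATED FOR THE WINDOW MODEL (`Dom B`, `Touch B`, `cellsOf`; size = the tree length
`dW` of a cube family): the geometric inputs DISCHARGED — `Ẽ = 0` off the localization domains under Kotecký–Preiss
(`locE_eq_zero_of_not_good`: the support of a cluster is face-connected, `good_biUnion_of_isPolymerCluster`), tree-length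
subadditivity over the touching domains (`treeLen_union_touching_le`, joining cost 2), (1.26)-summability
(`sum_exp_good_touching_le`, `sum_exp_domsWith_le`), the volume bound (`card_cellsOf_le_dW`) — giving
`norm_E0_window_le` (inputs: decay of `H′`, decay/smallness of `Ẽ` on localization domains, KP), `norm_locE_window_le`
(`Ẽ` small with tree decay from the decay of `H`, = `B13Resummation.norm_locE_le` on `TreeLengthCubeSystem.geometry`) and
`norm_E0_window_le_of_decay` (inputs: decay of `H`, `H′`, KP, explicit rate/smallness conditions).
NOT ASSERTED: the analytic content — the activities `H`, `H′` ((3.37)–(3.43): fluctuation integrals) are abstract and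
the Kotecký–Preiss condition is a HYPOTHESIS (in [Balaban1988Convergent] it follows from the activity bounds (2.42) /
(I.1.18), cf. `B13Resummation.kp_condition`); the constants of the printed bound (B₀ → O(p₀³(g_k)), the rate κ of
(2.42)) are not derived — `norm_E0_le` is the kernel step with its analytic and geometric inputs as hypotheses, and in
the window instance (I) the activity decay, the Kotecký–Preiss condition and the rate/smallness conditions are
hypotheses (in [Balaban1988Convergent] they come from (2.42)/(I.1.18) and the choice of κ, M); no new `Prop`-valued
fact (D-0026).
-/

namespace Literature.MathematicalPhysics.QuantumFieldTheory.Balaban1983to89.B14Eq344PolymerRatio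

open Finset
open Literature.Probability.LatticeModels
open Literature.MathematicalPhysics.QuantumFieldTheory.Balaban1983to89.B13FamilySum (coveringFamilies)
open Literature.MathematicalPhysics.QuantumFieldTheory.Balaban1983to89.B13Resummation (locE)

/-! ## Part A. (3.44) over the abstract hard-core polymer gas, and the separation of the marked polymer `Z₀` -/

section Abstract

variable {P : Type*} [DecidableEq P] (inc : P → P → Prop) [DecidableRel inc]

/-- **(3.44) p. 277** — *"[the nominator of the expectation value in (3.37)] = Σ_{{Z₀,…,Z_n}} H′(Z₀)·…·H(Z_n), … In
addition the domain Z₀ contains the bond b (or the point z). We can have n = 0, for n > 0 the factors H(Z_i) are the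
same as in the expansion of the denominator. The factor H′(Z₀) is different"*: the sum over the compatible families
`X ⊆ Λ` of polymers ((I.7.11) = [Balaban1988RG2Cluster] (2.11): pairwise `ζ = 1`) with a distinguished member `Z₀`
in `D` (the domains containing `b`; a compatible family has at most one, `card_inter_le_one`), weight
`H′(Z₀) Π_{Z ∈ X∖{Z₀}} H(Z)`. [cite: Balaban1988Convergent, (3.44) p.277] -/
def num344 (H' H : P → ℂ) (Λ D : Finset P) : ℂ :=
  ∑ X ∈ Λ.powerset with IsCompatible inc X, ∑ Z₀ ∈ X ∩ D, H' Z₀ * ∏ Z ∈ X.erase Z₀, H Z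

/-- **`Z̄₀ᶜ` of p. 278** at the level of polymers: the localization domains of `Λ` which *"do not intersect Z₀ along a
cube, or a wall of a cube"*, i.e. are compatible with `Z₀` (`Z ⊂ Z̄₀ᶜ`). [cite: Balaban1988Convergent, (3.45) p.278] -/
def compatVol (Λ : Finset P) (Z₀ : P) : Finset P := Λ.filter fun Z => ¬ inc Z₀ Z

variable {inc}

omit [DecidableEq P] in
/-- `Z̄₀ᶜ`-domains are domains of `Λ`. [cite: Balaban1988Convergent, (3.45) p.278] -/
theorem compatVol_subset (Λ : Finset P) (Z₀ : P) : compatVol inc Λ Z₀ ⊆ Λ := Finset.filter_subset _ Λ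

/-- `Z̄₀ᶜ` is `Λ` with the domains incompatible with `Z₀` removed. [cite: Balaban1988Convergent, (3.45) p.278] -/
theorem compatVol_eq_sdiff (Λ : Finset P) (Z₀ : P) :
    compatVol inc Λ Z₀ = Λ \ Λ.filter fun Z => inc Z₀ Z := by
  ext Z
  simp only [compatVol, Finset.mem_filter, Finset.mem_sdiff]
  tauto

omit [DecidableRel inc] in
/-- A compatible family contains at most one of the domains containing `b` (these are pairwise incompatible: they
share a cube) — so the distinguished `Z₀` of (3.44) is unique. [cite: Balaban1988Convergent, (3.44) p.277] -/
theorem card_inter_le_one {X D : Finset P} (hX : IsCompatible inc X)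
    (hclique : ∀ γ ∈ D, ∀ γ' ∈ D, γ ≠ γ' → inc γ γ') : (X ∩ D).card ≤ 1 := by
  rw [Finset.card_le_one]
  intro a ha b hb
  by_contra hab
  have ha' := Finset.mem_inter.1 ha
  have hb' := Finset.mem_inter.1 hb
  exact hX (Finset.mem_coe.2 ha'.1) (Finset.mem_coe.2 hb'.1) hab (hclique a ha'.2 b hb'.2 hab)

/-- THE BIJECTION `{Z₀, Z₁, …, Z_n} ↦ {Z₁, …, Z_n}` behind the separation of p. 278: for fixed `Z₀ ∈ Λ`, the
compatible families `X ⊆ Λ` containing `Z₀`, weighted by `Π_{Z ∈ X∖{Z₀}} H(Z)`, sum to the polymer partition function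
`Ξ(Z̄₀ᶜ)` of the domains of `Λ` compatible with `Z₀` (*"It has the form (I.7.11), with the additional condition …
Z_i ⊂ Z̄₀ᶜ"*). [cite: Balaban1988Convergent, (3.45) p.278] -/
theorem sum_filter_mem_prod_erase (hsymm : ∀ γ γ' : P, inc γ γ' → inc γ' γ) (H : P → ℂ) {Λ : Finset P}
    {Z₀ : P} (hZ₀ : Z₀ ∈ Λ) (hrefl : inc Z₀ Z₀) :
    ∑ X ∈ Λ.powerset with (IsCompatible inc X ∧ Z₀ ∈ X), ∏ Z ∈ X.erase Z₀, H Z =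
      polymerPartitionFunction inc H (compatVol inc Λ Z₀) := by
  rw [polymerPartitionFunction_eq_sum_filter]
  refine Finset.sum_nbij' (fun X => X.erase Z₀) (fun Y => insert Z₀ Y) ?_ ?_ ?_ ?_ fun _ _ => rfl
  · intro X hX
    rw [Finset.mem_filter, Finset.mem_powerset] at hX ⊢
    obtain ⟨hXΛ, hcomp, hZX⟩ := hX
    refine ⟨fun Z hZ => ?_, hcomp.mono (Finset.erase_subset Z₀ X)⟩
    obtain ⟨hne, hZX'⟩ := Finset.mem_erase.1 hZ
    exact Finset.mem_filter.2 ⟨hXΛ hZX', hcomp (Finset.mem_coe.2 hZX) (Finset.mem_coe.2 hZX') hne.symm⟩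
  · intro Y hY
    rw [Finset.mem_filter, Finset.mem_powerset] at hY ⊢
    obtain ⟨hYΛ, hcomp⟩ := hY
    have hZY : Z₀ ∉ Y := fun h => (Finset.mem_filter.1 (hYΛ h)).2 hrefl
    refine ⟨Finset.insert_subset hZ₀ (hYΛ.trans (compatVol_subset Λ Z₀)), ?_, Finset.mem_insert_self Z₀ Y⟩
    exact (isCompatible_insert hsymm hZY).2 ⟨hcomp, fun Z hZ => (Finset.mem_filter.1 (hYΛ hZ)).2⟩
  · intro X hX
    exact Finset.insert_erase (Finset.mem_filter.1 hX).2.2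
  · intro Y hY
    have hYΛ := Finset.mem_powerset.1 (Finset.mem_filter.1 hY).1
    exact Finset.erase_insert fun h => (Finset.mem_filter.1 (hYΛ h)).2 hrefl

/-- **p. 278, the separation of `Z₀`** — *"In the sum (3.44) we separate the summation over Z₀, and for a fixed Z₀
we consider the remaining sum over {Z₁,…,Z_n}. It has the form (I.7.11), with the additional condition that the
domains Z_i do not intersect Z₀ along a cube, or a wall of a cube"*:
`num344 = Σ_{Z₀ ∈ D} H′(Z₀) · Ξ(Z̄₀ᶜ; H)`. [cite: Balaban1988Convergent, (3.45) p.278] -/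
theorem num344_eq_sum (hsymm : ∀ γ γ' : P, inc γ γ' → inc γ' γ) (H' H : P → ℂ) {Λ D : Finset P}
    (hD : D ⊆ Λ) (hrefl : ∀ Z ∈ D, inc Z Z) :
    num344 inc H' H Λ D = ∑ Z₀ ∈ D, H' Z₀ * polymerPartitionFunction inc H (compatVol inc Λ Z₀) := by
  unfold num344
  calc (∑ X ∈ Λ.powerset with IsCompatible inc X, ∑ Z₀ ∈ X ∩ D, H' Z₀ * ∏ Z ∈ X.erase Z₀, H Z)
      = ∑ Z₀ ∈ D, ∑ X ∈ (Λ.powerset.filter fun X => IsCompatible inc X).filter (fun X => Z₀ ∈ X),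
          H' Z₀ * ∏ Z ∈ X.erase Z₀, H Z :=
        Finset.sum_comm' fun X Z₀ => by
          simp only [Finset.mem_inter, Finset.mem_filter]
          tauto
    _ = ∑ Z₀ ∈ D, H' Z₀ * polymerPartitionFunction inc H (compatVol inc Λ Z₀) := by
        refine Finset.sum_congr rfl fun Z₀ hZ₀ => ?_
        rw [← Finset.mul_sum, Finset.filter_filter,
          sum_filter_mem_prod_erase hsymm H (hD hZ₀) (hrefl Z₀ hZ₀)]

/-! ## Part B. (3.45): *"The sum is exponentiated"* — under the Kotecký–Preiss condition -/

/-- p. 277: *"the factor is represented as exp Ẽ^{(k+1)}(Λ_{k+1})"* — the denominator `Ξ(Λ; H)` is the exponential of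
the Kotecký–Preiss logarithm `Ẽ(Λ) = polymerLogZ inc H Λ` ((I.7.12)), given the Kotecký–Preiss condition on `Λ`
([KoteckyPreiss1986] Theorem; tree `exp_polymerLogZ_of_kp`). [cite: Balaban1988Convergent, (3.45) p.278] -/
theorem denominator_eq_exp [Std.Refl inc] [Std.Symm inc] {H : P → ℂ} {a : P → ℝ} {Λ : Finset P}
    (hKP : IsKPVolume inc H a Λ) :
    polymerPartitionFunction inc H Λ = Complex.exp (polymerLogZ inc H Λ) :=
  (exp_polymerLogZ_of_kp hKP subset_rfl).symm

/-- The same for the restricted sum: `Ξ(Z̄₀ᶜ; H) = exp Ẽ(Λ, Z̄₀ᶜ)` with `Ẽ(Λ, Z̄₀ᶜ) = polymerLogZ inc H (compatVol inc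
Λ Z₀)` (*"the exponent is represented by (I.7.12), with the additional restriction on the polymers Z_i"*).
[cite: Balaban1988Convergent, (3.45) p.278] -/
theorem restricted_eq_exp [Std.Refl inc] [Std.Symm inc] {H : P → ℂ} {a : P → ℝ} {Λ : Finset P}
    (hKP : IsKPVolume inc H a Λ) (Z₀ : P) :
    polymerPartitionFunction inc H (compatVol inc Λ Z₀) =
      Complex.exp (polymerLogZ inc H (compatVol inc Λ Z₀)) :=
  (exp_polymerLogZ_of_kp hKP (compatVol_subset Λ Z₀)).symm

/-- **(3.45) p. 278** — `[the expectation value] = Σ_{Z₀⊃b} H′(Z₀) exp[Ẽ(Λ, Z̄₀ᶜ) − Ẽ(Λ)]`: the numerator (3.44)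
divided by the denominator `Ξ(Λ; H) = exp Ẽ(Λ)`, under the Kotecký–Preiss condition for the denominator
activities on `Λ` (and `D ⊆ Λ`). [cite: Balaban1988Convergent, (3.45) p.278] -/
theorem eq345 [Std.Refl inc] [Std.Symm inc] {H : P → ℂ} {a : P → ℝ} {Λ D : Finset P}
    (hKP : IsKPVolume inc H a Λ) (H' : P → ℂ) (hD : D ⊆ Λ) :
    num344 inc H' H Λ D / polymerPartitionFunction inc H Λ =
      ∑ Z₀ ∈ D, H' Z₀ * Complex.exp (polymerLogZ inc H (compatVol inc Λ Z₀) - polymerLogZ inc H Λ) := by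
  rw [num344_eq_sum inc_symm_of_symm H' H hD fun Z _ => Std.Refl.refl Z, Finset.sum_div]
  refine Finset.sum_congr rfl fun Z₀ _ => ?_
  rw [Complex.exp_sub, ← restricted_eq_exp hKP Z₀, ← denominator_eq_exp hKP, mul_div_assoc]

/-! ## Part C. (3.46): the difference of the exponents, and its resummation by support -/

/-- *"The difference in the exponential has the representation (I.7.12) with (Z₁,…,Z_n) satisfying the additonal
condition that at least one of the localization domains intersects Z₀ along a three-dimensional wall at least"*:
`Ẽ(Λ, Z̄₀ᶜ) − Ẽ(Λ) = −Σ_{C ⊆ Λ, some Z ∈ C incompatible with Z₀} Φᵀ(C)` — by [KoteckyPreiss1986] (2)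
(`polymerLogZ_eq_sum_truncatedWeight`, Möbius inversion) for `Λ` and for `Z̄₀ᶜ`; unconditional.
[cite: Balaban1988Convergent, (3.46) p.278] -/
theorem polymerLogZ_compatVol_sub (H : P → ℂ) (Λ : Finset P) (Z₀ : P) :
    polymerLogZ inc H (compatVol inc Λ Z₀) - polymerLogZ inc H Λ =
      -∑ C ∈ Λ.powerset with (∃ Z ∈ C, inc Z₀ Z), truncatedWeight inc H C := by
  have hset : Λ.powerset.filter (fun C => ¬ ∃ Z ∈ C, inc Z₀ Z) = (compatVol inc Λ Z₀).powerset := by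
    ext C
    rw [Finset.mem_filter, Finset.mem_powerset, Finset.mem_powerset]
    unfold compatVol
    constructor
    · rintro ⟨hC, hno⟩ Z hZ
      exact Finset.mem_filter.2 ⟨hC hZ, fun h => hno ⟨Z, hZ, h⟩⟩
    · intro hC
      refine ⟨fun Z hZ => (Finset.mem_filter.1 (hC hZ)).1, ?_⟩
      rintro ⟨Z, hZ, h⟩
      exact (Finset.mem_filter.1 (hC hZ)).2 h
  rw [polymerLogZ_eq_sum_truncatedWeight, polymerLogZ_eq_sum_truncatedWeight,
    ← Finset.sum_filter_add_sum_filter_not Λ.powerset (fun C => ∃ Z ∈ C, inc Z₀ Z), hset]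
  ring

/-- **(3.45) with the difference expanded**: `[the expectation value] = Σ_{Z₀∈D} H′(Z₀) exp[−Σ_{C} Φᵀ(C)]`, the
clusters `C ⊆ Λ` having at least one member incompatible with `Z₀` ([KoteckyPreiss1986] (5)).
[cite: Balaban1988Convergent, (3.46) p.278] -/
theorem eq346_clusters [Std.Refl inc] [Std.Symm inc] {H : P → ℂ} {a : P → ℝ} {Λ D : Finset P}
    (hKP : IsKPVolume inc H a Λ) (H' : P → ℂ) (hD : D ⊆ Λ) :
    num344 inc H' H Λ D / polymerPartitionFunction inc H Λ =
      ∑ Z₀ ∈ D, H' Z₀ *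
        Complex.exp (-∑ C ∈ Λ.powerset with (∃ Z ∈ C, inc Z₀ Z), truncatedWeight inc H C) := by
  rw [eq345 hKP H' hD]
  exact Finset.sum_congr rfl fun Z₀ _ => by rw [polymerLogZ_compatVol_sub]

variable (inc)
variable {Cube : Type*} [DecidableEq Cube]

/-- **`Ẽ^{(k+1)}(Λ_{k+1}, Y)`** (p. 277: *"given by (I.7.12), with terms given by (I.7.13), but with the localization
domains … having nonempty intersections with Λ_{k+1}"*): the sum of the truncated functionals `Φᵀ(C)` over the
families `C` of polymers FROM `Λ` whose footprints unite to `Y` (`B13FamilySum.coveringFamilies Λ cubes Y`) — the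
`Λ`-restricted form of `B13Resummation.locE` ((I.7.13) = [Balaban1988RG2Cluster] (2.13)), `Etilde_univ`.
[cite: Balaban1988Convergent, (3.46) p.278] -/
noncomputable def Etilde (Λ : Finset P) (cubes : P → Finset Cube) (H : P → ℂ) (Y : Finset Cube) : ℂ :=
  ∑ C ∈ coveringFamilies Λ cubes Y, truncatedWeight inc H C

/-- When `Λ` is the whole (finite) catalogue of polymers, `Ẽ(Λ, Y)` is the tree's `B13Resummation.locE`
((I.7.13)). [cite: Balaban1988Convergent, (3.46) p.278] -/
theorem Etilde_univ [Fintype P] (cubes : P → Finset Cube) (H : P → ℂ) (Y : Finset Cube) :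
    Etilde inc Finset.univ cubes H Y = locE inc cubes H Y := rfl

/-- (I.7.12) resummed by support: `Ẽ(Λ) = Σ_Y Ẽ(Λ, Y)` over the finitely many unions `Y` of footprints
(as `B13Resummation.logZ_eq_sum_locE`, for the sub-volume `Λ`). [cite: Balaban1988Convergent, (3.45) p.278] -/
theorem polymerLogZ_eq_sum_Etilde (Λ : Finset P) (cubes : P → Finset Cube) (H : P → ℂ) :
    polymerLogZ inc H Λ = ∑ Y ∈ Λ.powerset.image (fun C => C.biUnion cubes), Etilde inc Λ cubes H Y := by
  rw [polymerLogZ_eq_sum_truncatedWeight]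
  unfold Etilde coveringFamilies
  exact (Finset.sum_fiberwise_of_maps_to (fun C hC => Finset.mem_image_of_mem _ hC) _).symm

variable {inc}

/-- *"Resumming the terms of this representation according to (I.7.13)"*: when incompatibility with `Z₀` is a
property of the footprint (`inc Z₀ Z ↔` some cube of `Z` satisfies `t`), the sum of `Φᵀ(C)` over the families `C`
with a member incompatible with `Z₀` is `Σ_Y Ẽ(Λ, Y)` over the supports `Y` containing such a cube.
[cite: Balaban1988Convergent, (3.46) p.278] -/
theorem sum_touching_eq_sum_Etilde (Λ : Finset P) (cubes : P → Finset Cube) (H : P → ℂ) (Z₀ : P)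
    (t : Cube → Prop) [DecidablePred t] (hloc : ∀ Z ∈ Λ, inc Z₀ Z ↔ ∃ b ∈ cubes Z, t b) :
    ∑ C ∈ Λ.powerset with (∃ Z ∈ C, inc Z₀ Z), truncatedWeight inc H C =
      ∑ Y ∈ (Λ.powerset.image fun C => C.biUnion cubes) with (∃ b ∈ Y, t b), Etilde inc Λ cubes H Y := by
  have hmaps : ∀ C ∈ Λ.powerset.filter (fun C => ∃ Z ∈ C, inc Z₀ Z),
      C.biUnion cubes ∈ (Λ.powerset.image fun C => C.biUnion cubes).filter (fun Y => ∃ b ∈ Y, t b) := by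
    intro C hC
    obtain ⟨hCΛ, Z, hZ, hinc⟩ := Finset.mem_filter.1 hC
    refine Finset.mem_filter.2 ⟨Finset.mem_image_of_mem _ hCΛ, ?_⟩
    obtain ⟨b, hb, htb⟩ := (hloc Z (Finset.mem_powerset.1 hCΛ hZ)).1 hinc
    exact ⟨b, Finset.mem_biUnion.2 ⟨Z, hZ, hb⟩, htb⟩
  rw [← Finset.sum_fiberwise_of_maps_to hmaps]
  refine Finset.sum_congr rfl fun Y hY => ?_
  obtain ⟨-, b, hb, htb⟩ := Finset.mem_filter.1 hY
  unfold Etilde coveringFamilies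
  refine Finset.sum_congr ?_ fun _ _ => rfl
  ext C
  simp only [Finset.mem_filter, Finset.mem_powerset]
  constructor
  · rintro ⟨⟨hCΛ, -⟩, hC⟩
    exact ⟨hCΛ, hC⟩
  · rintro ⟨hCΛ, hC⟩
    refine ⟨⟨hCΛ, ?_⟩, hC⟩
    rw [← hC] at hb
    obtain ⟨Z, hZ, hbZ⟩ := Finset.mem_biUnion.1 hb
    exact ⟨Z, hZ, (hloc Z (hCΛ hZ)).2 ⟨b, hbZ, htb⟩⟩

/-- **(3.46) p. 278** — `[the expectation value] = Σ_{Z₀⊃b} H′(Z₀) exp[−Σ_Y Ẽ(Λ, Y)]`, *"The sum in the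
exponential is over the localization domains Y satisfying both conditions relative to Λ_{k+1}, Z₀"* (families from
`Λ`; support `Y` touching `Z₀`): for footprint-local incompatibility, under the Kotecký–Preiss condition for the
denominator activities on `Λ`, `D ⊆ Λ`. [cite: Balaban1988Convergent, (3.46) p.278] -/
theorem eq346 [Std.Refl inc] [Std.Symm inc] {H : P → ℂ} {a : P → ℝ} {Λ D : Finset P}
    (hKP : IsKPVolume inc H a Λ) (H' : P → ℂ) (hD : D ⊆ Λ) (cubes : P → Finset Cube)
    (t : P → Cube → Prop) [∀ Z₀, DecidablePred (t Z₀)]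
    (hloc : ∀ Z₀ ∈ D, ∀ Z ∈ Λ, inc Z₀ Z ↔ ∃ b ∈ cubes Z, t Z₀ b) :
    num344 inc H' H Λ D / polymerPartitionFunction inc H Λ =
      ∑ Z₀ ∈ D, H' Z₀ * Complex.exp
        (-∑ Y ∈ (Λ.powerset.image fun C => C.biUnion cubes) with (∃ b ∈ Y, t Z₀ b),
            Etilde inc Λ cubes H Y) := by
  rw [eq346_clusters hKP H' hD]
  exact Finset.sum_congr rfl fun Z₀ hZ₀ => by
    rw [sum_touching_eq_sum_Etilde Λ cubes H Z₀ (t Z₀) (hloc Z₀ hZ₀)]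

end Abstract

/-! ## Part D. The window-model instance: localization domains of a window `B`, ζ of (I.7.11) = `Touch B` -/

section Window

open Literature.MathematicalPhysics.QuantumFieldTheory.Balaban1983to89.B13ScaleTransfer (Pt Adj)
open Literature.MathematicalPhysics.QuantumFieldTheory.Balaban1983to89.TreeLengthCubeSystem
  (Dom Cell cellsOf mem_cellsOf Touch touch_refl touch_symm)

variable {d : ℕ} (B : Finset (Pt d))

/-- «`Y` intersects `Z₀` along a three-dimensional wall at least» (or along a cube), at the level of footprints:
some cube of `Y` is a cube of `Z₀` or shares a wall with one (the negation of the `ζ = 1` condition of (I.7.11)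
between `Z₀` and the union `Y`). [cite: Balaban1988Convergent, (3.46) p.278] -/
def TouchesCells (Z₀ : Dom B) (Y : Finset (Cell B)) : Prop :=
  ∃ b ∈ Y, ∃ a ∈ cellsOf B Z₀.1, a = b ∨ Adj a.1 b.1

/-- The incompatibility `Touch B` of the window's polymer gas is footprint-local in the sense of `eq346`:
`Touch B Z₀ Z ↔ TouchesCells B Z₀ (cells of Z)`. [cite: Balaban1988Convergent, (3.46) p.278] -/
theorem touch_iff_touchesCells (Z₀ Z : Dom B) : Touch B Z₀ Z ↔ TouchesCells B Z₀ (cellsOf B Z.1) := by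
  constructor
  · rintro ⟨a, ha, b, hb, h⟩
    exact ⟨b, hb, a, ha, h⟩
  · rintro ⟨b, hb, a, ha, h⟩
    exact ⟨a, ha, b, hb, h⟩

/-- The localization domains of the window containing the cube `c` (*"the domain Z₀ contains the bond b (or the
point z)"*, at cube level: the cube of `b` / of `z`). [cite: Balaban1988Convergent, (3.44) p.277] -/
noncomputable def domsWith (c : Cell B) : Finset (Dom B) := Finset.univ.filter fun X => c ∈ cellsOf B X.1

/-- Membership in `domsWith`. [cite: Balaban1988Convergent, (3.44) p.277] -/
theorem mem_domsWith {c : Cell B} {X : Dom B} : X ∈ domsWith B c ↔ c ∈ cellsOf B X.1 := by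
  rw [domsWith, Finset.mem_filter, and_iff_right (Finset.mem_univ X)]

/-- Two domains containing the cube `c` are incompatible (they share a cube): the domains containing `b` form a
clique, so a compatible family has at most one of them (`card_inter_le_one`). [cite: Balaban1988Convergent, (3.44) p.277] -/
theorem touch_of_mem_domsWith {c : Cell B} {X X' : Dom B} (hX : X ∈ domsWith B c) (hX' : X' ∈ domsWith B c) :
    Touch B X X' :=
  ⟨c, (mem_domsWith B).1 hX, c, (mem_domsWith B).1 hX', Or.inl rfl⟩

open Classical in
/-- **(3.44)–(3.46) FOR THE WINDOW MODEL** (polymers = localization domains of the window `B`, `ζ` of (I.7.11) =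
`TreeLengthCubeSystem.Touch B`, footprints `cellsOf`, `Λ` = all of them): under the Kotecký–Preiss condition for the
denominator activities, `num344 / Ξ = Σ_{Z₀ ∋ c} H′(Z₀) exp[−Σ_{Y touching Z₀} E(Y)]`, the exponent summing the
tree's `B13Resummation.locE (Touch B) cellsOf H Y` ((I.7.13)) over the unions `Y` of footprints touching `Z₀`.
[cite: Balaban1988Convergent, (3.46) p.278] -/
theorem eq346_window {H : Dom B → ℂ} {a : Dom B → ℝ} (hKP : IsKPVolume (Touch B) H a Finset.univ)
    (H' : Dom B → ℂ) (c : Cell B) :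
    num344 (Touch B) H' H Finset.univ (domsWith B c) / polymerPartitionFunction (Touch B) H Finset.univ =
      ∑ Z₀ ∈ domsWith B c, H' Z₀ * Complex.exp
        (-∑ Y ∈ ((Finset.univ : Finset (Dom B)).powerset.image fun C => C.biUnion fun X => cellsOf B X.1)
            with TouchesCells B Z₀ Y, locE (Touch B) (fun X => cellsOf B X.1) H Y) := by
  haveI : Std.Refl (Touch B) := ⟨touch_refl B⟩
  haveI : Std.Symm (Touch B) := ⟨touch_symm B⟩
  rw [eq346 hKP H' (Finset.subset_univ (domsWith B c)) (fun X : Dom B => cellsOf B X.1)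
    (fun (Z₀ : Dom B) (b : Cell B) => ∃ a ∈ cellsOf B Z₀.1, a = b ∨ Adj a.1 b.1)
    (fun Z₀ _ Z _ => touch_iff_touchesCells B Z₀ Z)]
  refine Finset.sum_congr rfl fun Z₀ _ => ?_
  congr 3
  exact Finset.sum_congr (Finset.filter_congr fun Y _ => Iff.rfl) fun _ _ => rfl

end Window

/-! ## Part E (v1.1, append-only). (3.47): the Mayer re-expansion of the exponential of (3.46), resummed over the
domains `X ⊃ b` -/

section Mayer347

variable {P Cube : Type*} [DecidableEq Cube]

/-- **`E₀^{(k+1)}(Λ_{k+1}, X, b)` of (3.47) p. 278** — *"the exponential on the right-hand side of (3.46) is expanded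
into the Mayer expansion, as the action density (I.7.1). This, after the proper resummation, yields the representation
(3.47)"*: for the marked domains `Z₀ ∈ D` (those containing `b`), the families `𝒴` of supports `Y` from the index
set `T Z₀` of the exponent of (3.46) (the `Y` touching `Z₀`), the Mayer factors `Π_{Y∈𝒴} (e^{−Ẽ(Λ,Y)} − 1)`, resummed
over the total support `X = (cubes of Z₀) ∪ ⋃𝒴`. [cite: Balaban1988Convergent, (3.47) p.278] -/
noncomputable def E0 (D : Finset P) (T : P → Finset (Finset Cube)) (cubes : P → Finset Cube) (H' : P → ℂ)
    (E : Finset Cube → ℂ) (X : Finset Cube) : ℂ :=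
  ∑ Z₀ ∈ D, H' Z₀ *
    ∑ 𝒴 ∈ (T Z₀).powerset with cubes Z₀ ∪ 𝒴.biUnion id = X, ∏ Y ∈ 𝒴, (Complex.exp (-E Y) - 1)

/-- The supports `X` occurring in (3.47): `(cubes of Z₀) ∪ ⋃𝒴` for `Z₀ ∈ D`, `𝒴 ⊆ T Z₀` — every one contains the
cubes of a marked domain, hence the cube of `b` (*"X ⊃ b"*). [cite: Balaban1988Convergent, (3.47) p.278] -/
noncomputable def supports347 (D : Finset P) (T : P → Finset (Finset Cube)) (cubes : P → Finset Cube) :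
    Finset (Finset Cube) :=
  D.biUnion fun Z₀ => (T Z₀).powerset.image fun 𝒴 => cubes Z₀ ∪ 𝒴.biUnion id

/-- Every support of (3.47) contains the cubes of some marked domain `Z₀ ∈ D` (so `X ⊃ b`).
[cite: Balaban1988Convergent, (3.47) p.278] -/
theorem exists_subset_of_mem_supports347 {D : Finset P} {T : P → Finset (Finset Cube)} {cubes : P → Finset Cube}
    {X : Finset Cube} (hX : X ∈ supports347 D T cubes) : ∃ Z₀ ∈ D, cubes Z₀ ⊆ X := by
  obtain ⟨Z₀, hZ₀, hX⟩ := Finset.mem_biUnion.1 hX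
  obtain ⟨𝒴, -, rfl⟩ := Finset.mem_image.1 hX
  exact ⟨Z₀, hZ₀, Finset.subset_union_left⟩

omit [DecidableEq Cube] in
/-- The Mayer expansion of the exponential of (3.46) (*"expanded into the Mayer expansion, as the action density
(I.7.1)"*; the combinatorial identity of `B13MayerDecoupling.exp_sum_eq_sum_powerset_prod`, [Balaban1988RG2Cluster]
(2.1)): `exp[−Σ_{Y∈T} Ẽ(Y)] = Σ_{𝒴⊆T} Π_{Y∈𝒴} (e^{−Ẽ(Y)} − 1)`. [cite: Balaban1988Convergent, (3.47) p.278] -/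
theorem exp_neg_sum_eq_sum_powerset_prod (T : Finset (Finset Cube)) (E : Finset Cube → ℂ) :
    Complex.exp (-∑ Y ∈ T, E Y) = ∑ 𝒴 ∈ T.powerset, ∏ Y ∈ 𝒴, (Complex.exp (-E Y) - 1) := by
  rw [← Finset.sum_neg_distrib, Complex.exp_sum, ← Finset.prod_one_add]
  exact Finset.prod_congr rfl fun Y _ => by ring

/-- **(3.46) ⇒ (3.47) p. 278**: `Σ_{Z₀⊃b} H′(Z₀) exp[−Σ_{Y ∈ T Z₀} Ẽ(Λ, Y)] = Σ_{X} E₀(Λ, X, b)` — the Mayer expansion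
((I.7.1), `exp_neg_sum_eq_sum_powerset_prod`) followed by the resummation over the total support `X`; an exact
finite identity, for every exponent function `Ẽ`. [cite: Balaban1988Convergent, (3.47) p.278] -/
theorem eq347 (D : Finset P) (T : P → Finset (Finset Cube)) (cubes : P → Finset Cube) (H' : P → ℂ)
    (E : Finset Cube → ℂ) :
    ∑ Z₀ ∈ D, H' Z₀ * Complex.exp (-∑ Y ∈ T Z₀, E Y) =
      ∑ X ∈ supports347 D T cubes, E0 D T cubes H' E X := by
  unfold E0
  rw [Finset.sum_comm]
  refine Finset.sum_congr rfl fun Z₀ hZ₀ => ?_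
  rw [← Finset.mul_sum]
  congr 1
  rw [exp_neg_sum_eq_sum_powerset_prod,
    ← Finset.sum_fiberwise_of_maps_to (g := fun 𝒴 : Finset (Finset Cube) => cubes Z₀ ∪ 𝒴.biUnion id)
      (t := supports347 D T cubes) fun 𝒴 h𝒴 =>
        Finset.mem_biUnion.2 ⟨Z₀, hZ₀, Finset.mem_image_of_mem _ h𝒴⟩]

end Mayer347

/-! ## Part F (v1.1, append-only). (3.44)–(3.47) for the window model -/

section Window347

open Literature.MathematicalPhysics.QuantumFieldTheory.Balaban1983to89.B13ScaleTransfer (Pt Adj)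
open Literature.MathematicalPhysics.QuantumFieldTheory.Balaban1983to89.TreeLengthCubeSystem
  (Dom Cell cellsOf mem_cellsOf Touch touch_refl touch_symm)

variable {d : ℕ} (B : Finset (Pt d))

/-- In the window model every support `X` of (3.47) contains the marked cube `c` (*"X ⊃ b"*).
[cite: Balaban1988Convergent, (3.47) p.278] -/
theorem mem_of_mem_supports347 {c : Cell B} {T : Dom B → Finset (Finset (Cell B))} {X : Finset (Cell B)}
    (hX : X ∈ supports347 (domsWith B c) T fun Z : Dom B => cellsOf B Z.1) : c ∈ X := by
  obtain ⟨Z₀, hZ₀, hsub⟩ := exists_subset_of_mem_supports347 hX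
  exact hsub ((mem_domsWith B).1 hZ₀)

open Classical in
/-- **(3.44)–(3.47) FOR THE WINDOW MODEL**: under the Kotecký–Preiss condition for the denominator activities,
`num344 / Ξ = Σ_{X ∋ c} E₀(X, c)`, the terms `E0` built from the marked activities `H′`, the Mayer factors
`e^{−E(Y)} − 1` of the tree's `B13Resummation.locE (Touch B) cellsOf H Y` over the supports `Y` touching `Z₀`, and
resummed over `X = Z₀ ∪ ⋃Y` (`eq346_window` + `eq347`). [cite: Balaban1988Convergent, (3.47) p.278] -/
theorem eq347_window {H : Dom B → ℂ} {a : Dom B → ℝ} (hKP : IsKPVolume (Touch B) H a Finset.univ)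
    (H' : Dom B → ℂ) (c : Cell B) :
    num344 (Touch B) H' H Finset.univ (domsWith B c) / polymerPartitionFunction (Touch B) H Finset.univ =
      ∑ X ∈ supports347 (domsWith B c)
          (fun Z₀ => ((Finset.univ : Finset (Dom B)).powerset.image
            fun C => C.biUnion fun X => cellsOf B X.1).filter (TouchesCells B Z₀))
          (fun Z : Dom B => cellsOf B Z.1),
        E0 (domsWith B c)
          (fun Z₀ => ((Finset.univ : Finset (Dom B)).powerset.image
            fun C => C.biUnion fun X => cellsOf B X.1).filter (TouchesCells B Z₀))
          (fun Z : Dom B => cellsOf B Z.1) H' (locE (Touch B) (fun Z : Dom B => cellsOf B Z.1) H) X := by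
  rw [eq346_window B hKP H' c]
  exact eq347 _ _ _ _ _

end Window347

/-! ## Part G (v1.2, append-only). p. 278: *"The terms of the sum above satisfy the bounds (2.42)"* — a kernel
bound for the (3.47) terms `E₀(Λ, X, b)` over the abstract polymer gas -/

section Bound347

variable {P Cube : Type*} [DecidableEq Cube]

/-- **The (3.47) terms obey a (2.42)-type bound** — p. 278, verbatim: *"The terms of the sum above satisfy the bounds
(2.42), with the constant B₀ replaced by O(p₀³(g_k))"* ((2.42) p. 261: `|𝐁^{(j)}(X,(U,J,A),{S_i∩X})| ≤ B₀ exp(−κd_j(X))`).  KERNEL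
FORM over the abstract polymer gas, for the terms `E0` of `eq347`, with every analytic and geometric input an explicit
hypothesis (shapes as in `B13Resummation.norm_locE_le` / `B13FamilySum`): a size `d ≥ 0` on families of cubes;
decay of the marked activities `‖H′(Z₀)‖ ≤ A′e^{−R d(Z₀)}`; smallness-with-decay of the exponents
`‖Ẽ(Λ,Y)‖ ≤ ε e^{−r d(Y)}`, `ε ≤ 1` (for `Ẽ = locE` this is `B13Resummation.norm_locE_le`); subadditivity of `d` over
the marked domain and the supports touching it with joining cost `c` ((2.27)/(2.32)-type); (1.26)-type summability of
the touching supports (`Σ_{Y ∈ T Z₀} e^{−(r−κ)d(Y)} ≤ K·#cubes Z₀`) and of the marked domains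
(`Σ_{Z₀∈D} e^{−κ₂ d(Z₀)} ≤ K_D`); the volume bound `#cubes Z₀ ≤ c₁(1 + d(Z₀))`; and the rate condition
`κ + 2εe^{κc}Kc₁ + κ₂ ≤ R`.  THEN `‖E₀(X)‖ ≤ A′ e^{2εe^{κc}Kc₁} K_D · e^{−κ d(X)}` for every `X`.  Proof: Mayer factors
`‖e^{−Ẽ} − 1‖ ≤ 2‖Ẽ‖` (Mathlib `Complex.norm_exp_sub_one_le`), `e^{κd(X)} ≤ e^{κd(Z₀)}Π_Y e^{κ(d(Y)+c)}` on each family,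
the constraint `Z₀ ∪ ⋃𝒴 = X` dropped, `Σ_{𝒴⊆T}Π u = Π(1+u) ≤ e^{Σu}`, then the two summability inputs.
[cite: Balaban1988Convergent, (3.47) p.278] -/
theorem norm_E0_le (D : Finset P) (T : P → Finset (Finset Cube)) (cubes : P → Finset Cube) (H' : P → ℂ)
    (E : Finset Cube → ℂ) (d : Finset Cube → ℝ) {A' R r κ c ε K c₁ κ₂ K_D : ℝ}
    (hd : ∀ Y, 0 ≤ d Y) (hκ : 0 ≤ κ) (hε : 0 ≤ ε) (hε1 : ε ≤ 1) (hr : 0 ≤ r) (hK : 0 ≤ K) (hc₁ : 0 ≤ c₁)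
    (hA' : 0 ≤ A')
    (hsub : ∀ Z₀ ∈ D, ∀ 𝒴 ⊆ T Z₀, d (cubes Z₀ ∪ 𝒴.biUnion id) ≤ d (cubes Z₀) + ∑ Y ∈ 𝒴, (d Y + c))
    (hE : ∀ Z₀ ∈ D, ∀ Y ∈ T Z₀, ‖E Y‖ ≤ ε * Real.exp (-(r * d Y)))
    (hsumT : ∀ Z₀ ∈ D, ∑ Y ∈ T Z₀, Real.exp (-((r - κ) * d Y)) ≤ K * (cubes Z₀).card)
    (hH' : ∀ Z₀ ∈ D, ‖H' Z₀‖ ≤ A' * Real.exp (-(R * d (cubes Z₀))))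
    (hvol : ∀ Z₀ ∈ D, ((cubes Z₀).card : ℝ) ≤ c₁ * (1 + d (cubes Z₀)))
    (hsumD : ∑ Z₀ ∈ D, Real.exp (-(κ₂ * d (cubes Z₀))) ≤ K_D)
    (hrate : κ + 2 * ε * Real.exp (κ * c) * K * c₁ + κ₂ ≤ R) (X : Finset Cube) :
    ‖E0 D T cubes H' E X‖ ≤
      A' * Real.exp (2 * ε * Real.exp (κ * c) * K * c₁) * K_D * Real.exp (-(κ * d X)) := by
  set s : ℝ := 2 * ε * Real.exp (κ * c) * K * c₁ with hs
  have hs0 : 0 ≤ s := by positivity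
  set u : Finset Cube → ℝ := fun Y => Real.exp (κ * (d Y + c)) * (2 * ε * Real.exp (-(r * d Y))) with hu
  have hu0 : ∀ Y, 0 ≤ u Y := fun Y => by positivity
  -- Step 1: one family `𝒴` with `Z₀ ∪ ⋃𝒴 = X`
  have step1 : ∀ Z₀ ∈ D, ∀ 𝒴 ∈ (T Z₀).powerset, cubes Z₀ ∪ 𝒴.biUnion id = X →
      Real.exp (κ * d X) * ‖∏ Y ∈ 𝒴, (Complex.exp (-E Y) - 1)‖ ≤
        Real.exp (κ * d (cubes Z₀)) * ∏ Y ∈ 𝒴, u Y := by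
    intro Z₀ hZ₀ 𝒴 h𝒴 hX
    have h𝒴T : 𝒴 ⊆ T Z₀ := Finset.mem_powerset.1 h𝒴
    have hnorm : ‖∏ Y ∈ 𝒴, (Complex.exp (-E Y) - 1)‖ ≤ ∏ Y ∈ 𝒴, (2 * ε * Real.exp (-(r * d Y))) := by
      refine (Finset.norm_prod_le _ _).trans (Finset.prod_le_prod (fun Y _ => norm_nonneg _) fun Y hY => ?_)
      have hEY := hE Z₀ hZ₀ Y (h𝒴T hY)
      have hE1 : ‖-E Y‖ ≤ 1 := by
        rw [norm_neg]
        refine hEY.trans ?_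
        have hexp1 : Real.exp (-(r * d Y)) ≤ 1 :=
          Real.exp_le_one_iff.2 (by nlinarith [hd Y, hr])
        nlinarith [Real.exp_nonneg (-(r * d Y))]
      calc ‖Complex.exp (-E Y) - 1‖ ≤ 2 * ‖-E Y‖ := Complex.norm_exp_sub_one_le hE1
        _ = 2 * ‖E Y‖ := by rw [norm_neg]
        _ ≤ 2 * (ε * Real.exp (-(r * d Y))) := by gcongr
        _ = 2 * ε * Real.exp (-(r * d Y)) := by ring
    have hexp : Real.exp (κ * d X) ≤
        Real.exp (κ * d (cubes Z₀)) * ∏ Y ∈ 𝒴, Real.exp (κ * (d Y + c)) := by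
      rw [← Real.exp_sum, ← Real.exp_add, Real.exp_le_exp, ← Finset.mul_sum, ← mul_add, ← hX]
      exact mul_le_mul_of_nonneg_left (hsub Z₀ hZ₀ 𝒴 h𝒴T) hκ
    calc Real.exp (κ * d X) * ‖∏ Y ∈ 𝒴, (Complex.exp (-E Y) - 1)‖
        ≤ (Real.exp (κ * d (cubes Z₀)) * ∏ Y ∈ 𝒴, Real.exp (κ * (d Y + c))) *
            ∏ Y ∈ 𝒴, (2 * ε * Real.exp (-(r * d Y))) :=
          mul_le_mul hexp hnorm (norm_nonneg _) (by positivity)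
      _ = Real.exp (κ * d (cubes Z₀)) * ∏ Y ∈ 𝒴, u Y := by
          rw [mul_assoc, ← Finset.prod_mul_distrib]
  -- Step 2: the sum over the families, constraint dropped, `Σ Π u = Π (1 + u) ≤ exp Σ u`
  have step2 : ∀ Z₀ ∈ D,
      ∑ 𝒴 ∈ (T Z₀).powerset with cubes Z₀ ∪ 𝒴.biUnion id = X,
          Real.exp (κ * d X) * ‖∏ Y ∈ 𝒴, (Complex.exp (-E Y) - 1)‖ ≤
        Real.exp (κ * d (cubes Z₀)) * Real.exp (∑ Y ∈ T Z₀, u Y) := by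
    intro Z₀ hZ₀
    calc ∑ 𝒴 ∈ (T Z₀).powerset with cubes Z₀ ∪ 𝒴.biUnion id = X,
          Real.exp (κ * d X) * ‖∏ Y ∈ 𝒴, (Complex.exp (-E Y) - 1)‖
        ≤ ∑ 𝒴 ∈ (T Z₀).powerset with cubes Z₀ ∪ 𝒴.biUnion id = X,
            Real.exp (κ * d (cubes Z₀)) * ∏ Y ∈ 𝒴, u Y :=
          Finset.sum_le_sum fun 𝒴 h𝒴 =>
            step1 Z₀ hZ₀ 𝒴 (Finset.mem_filter.1 h𝒴).1 (Finset.mem_filter.1 h𝒴).2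
      _ ≤ ∑ 𝒴 ∈ (T Z₀).powerset, Real.exp (κ * d (cubes Z₀)) * ∏ Y ∈ 𝒴, u Y :=
          Finset.sum_le_sum_of_subset_of_nonneg (Finset.filter_subset _ _) fun 𝒴 _ _ =>
            mul_nonneg (Real.exp_nonneg _) (Finset.prod_nonneg fun Y _ => hu0 Y)
      _ = Real.exp (κ * d (cubes Z₀)) * ∏ Y ∈ T Z₀, (1 + u Y) := by
          rw [← Finset.mul_sum, Finset.prod_one_add]
      _ ≤ Real.exp (κ * d (cubes Z₀)) * Real.exp (∑ Y ∈ T Z₀, u Y) := by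
          refine mul_le_mul_of_nonneg_left ?_ (Real.exp_nonneg _)
          rw [Real.exp_sum]
          exact Finset.prod_le_prod (fun Y _ => by linarith [hu0 Y]) fun Y _ => by
            linarith [Real.add_one_le_exp (u Y)]
  -- Step 3: the touching supports are summable at rate `r − κ`
  have step3 : ∀ Z₀ ∈ D, ∑ Y ∈ T Z₀, u Y ≤ s * (1 + d (cubes Z₀)) := by
    intro Z₀ hZ₀
    have hrw : ∀ Y, u Y = 2 * ε * Real.exp (κ * c) * Real.exp (-((r - κ) * d Y)) := by
      intro Y
      simp only [hu]
      rw [show κ * (d Y + c) = κ * c + κ * d Y by ring, Real.exp_add,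
        show -((r - κ) * d Y) = κ * d Y + -(r * d Y) by ring, Real.exp_add]
      ring
    calc ∑ Y ∈ T Z₀, u Y = 2 * ε * Real.exp (κ * c) * ∑ Y ∈ T Z₀, Real.exp (-((r - κ) * d Y)) := by
          rw [Finset.mul_sum]
          exact Finset.sum_congr rfl fun Y _ => hrw Y
      _ ≤ 2 * ε * Real.exp (κ * c) * (K * (cubes Z₀).card) :=
          mul_le_mul_of_nonneg_left (hsumT Z₀ hZ₀) (by positivity)
      _ ≤ 2 * ε * Real.exp (κ * c) * (K * (c₁ * (1 + d (cubes Z₀)))) :=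
          mul_le_mul_of_nonneg_left (mul_le_mul_of_nonneg_left (hvol Z₀ hZ₀) hK) (by positivity)
      _ = s * (1 + d (cubes Z₀)) := by simp only [hs]; ring
  -- Step 4: assemble with the marked activities
  have hE0 : ‖E0 D T cubes H' E X‖ ≤ ∑ Z₀ ∈ D, ‖H' Z₀‖ *
      ∑ 𝒴 ∈ (T Z₀).powerset with cubes Z₀ ∪ 𝒴.biUnion id = X,
        ‖∏ Y ∈ 𝒴, (Complex.exp (-E Y) - 1)‖ := by
    unfold E0
    refine (norm_sum_le _ _).trans (Finset.sum_le_sum fun Z₀ _ => ?_)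
    rw [norm_mul]
    exact mul_le_mul_of_nonneg_left (norm_sum_le _ _) (norm_nonneg _)
  have key : Real.exp (κ * d X) * ‖E0 D T cubes H' E X‖ ≤ A' * Real.exp s * K_D := by
    calc Real.exp (κ * d X) * ‖E0 D T cubes H' E X‖
        ≤ Real.exp (κ * d X) * ∑ Z₀ ∈ D, ‖H' Z₀‖ *
            ∑ 𝒴 ∈ (T Z₀).powerset with cubes Z₀ ∪ 𝒴.biUnion id = X,
              ‖∏ Y ∈ 𝒴, (Complex.exp (-E Y) - 1)‖ :=
          mul_le_mul_of_nonneg_left hE0 (Real.exp_nonneg _)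
      _ = ∑ Z₀ ∈ D, ‖H' Z₀‖ *
            ∑ 𝒴 ∈ (T Z₀).powerset with cubes Z₀ ∪ 𝒴.biUnion id = X,
              Real.exp (κ * d X) * ‖∏ Y ∈ 𝒴, (Complex.exp (-E Y) - 1)‖ := by
          rw [Finset.mul_sum]
          refine Finset.sum_congr rfl fun Z₀ _ => ?_
          rw [mul_left_comm, Finset.mul_sum]
      _ ≤ ∑ Z₀ ∈ D, ‖H' Z₀‖ * (Real.exp (κ * d (cubes Z₀)) * Real.exp (s * (1 + d (cubes Z₀)))) := by
          refine Finset.sum_le_sum fun Z₀ hZ₀ => mul_le_mul_of_nonneg_left ?_ (norm_nonneg _)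
          exact (step2 Z₀ hZ₀).trans
            (mul_le_mul_of_nonneg_left (Real.exp_le_exp.2 (step3 Z₀ hZ₀)) (Real.exp_nonneg _))
      _ ≤ ∑ Z₀ ∈ D, A' * Real.exp s * Real.exp (-(κ₂ * d (cubes Z₀))) := by
          refine Finset.sum_le_sum fun Z₀ hZ₀ => ?_
          have hdd := hd (cubes Z₀)
          calc ‖H' Z₀‖ * (Real.exp (κ * d (cubes Z₀)) * Real.exp (s * (1 + d (cubes Z₀))))
              ≤ (A' * Real.exp (-(R * d (cubes Z₀)))) *
                  (Real.exp (κ * d (cubes Z₀)) * Real.exp (s * (1 + d (cubes Z₀)))) :=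
                mul_le_mul_of_nonneg_right (hH' Z₀ hZ₀) (by positivity)
            _ = A' * (Real.exp (-(R * d (cubes Z₀))) * Real.exp (κ * d (cubes Z₀)) *
                  Real.exp (s * (1 + d (cubes Z₀)))) := by ring
            _ = A' * Real.exp (s + -((R - κ - s) * d (cubes Z₀))) := by
                rw [← Real.exp_add, ← Real.exp_add]
                congr 1
                ring_nf
            _ = A' * Real.exp s * Real.exp (-((R - κ - s) * d (cubes Z₀))) := by
                rw [Real.exp_add, mul_assoc]
            _ ≤ A' * Real.exp s * Real.exp (-(κ₂ * d (cubes Z₀))) := by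
                refine mul_le_mul_of_nonneg_left (Real.exp_le_exp.2 ?_) (by positivity)
                have h1 : κ₂ * d (cubes Z₀) ≤ (R - κ - s) * d (cubes Z₀) :=
                  mul_le_mul_of_nonneg_right (by linarith) hdd
                linarith
      _ = A' * Real.exp s * ∑ Z₀ ∈ D, Real.exp (-(κ₂ * d (cubes Z₀))) := by rw [Finset.mul_sum]
      _ ≤ A' * Real.exp s * K_D := mul_le_mul_of_nonneg_left hsumD (by positivity)
  have hexp : Real.exp (-(κ * d X)) * (Real.exp (κ * d X) * ‖E0 D T cubes H' E X‖) =
      ‖E0 D T cubes H' E X‖ := by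
    rw [← mul_assoc, ← Real.exp_add, neg_add_cancel, Real.exp_zero, one_mul]
  calc ‖E0 D T cubes H' E X‖
      = Real.exp (-(κ * d X)) * (Real.exp (κ * d X) * ‖E0 D T cubes H' E X‖) := hexp.symm
    _ ≤ Real.exp (-(κ * d X)) * (A' * Real.exp s * K_D) :=
        mul_le_mul_of_nonneg_left key (Real.exp_nonneg _)
    _ = A' * Real.exp s * K_D * Real.exp (-(κ * d X)) := by ring

end Bound347

/-! ## Part H (v1.2, append-only). p. 278: *"the terms E₀^{(k+1)}(Λ_{k+1}, X, z) of this representation, for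
X ⊂ Λ_{k+1}, do not depend on Λ_{k+1} and coincide with the corresponding terms arising from the expressions defined on
the whole lattice"* — locality of the (3.47) terms -/

section Locality347

open Literature.MathematicalPhysics.QuantumFieldTheory.Balaban1983to89.B13FamilySum
  (inside mem_inside mem_coveringFamilies subset_inside_of_mem)

variable {P Cube : Type*} [DecidableEq Cube]

/-- The (3.47) term `E₀(X)` only involves the marked domains `Z₀` with `cubes Z₀ ⊆ X` and the supports `Y ⊆ X`:
restricting `D` and each `T Z₀` accordingly does not change it (the constraint `Z₀ ∪ ⋃𝒴 = X`).
[cite: Balaban1988Convergent, (3.47) p.278] -/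
theorem E0_restrict (D : Finset P) (T : P → Finset (Finset Cube)) (cubes : P → Finset Cube) (H' : P → ℂ)
    (E : Finset Cube → ℂ) (X : Finset Cube) :
    E0 D T cubes H' E X =
      E0 (D.filter fun Z₀ => cubes Z₀ ⊆ X) (fun Z₀ => (T Z₀).filter fun Y => Y ⊆ X) cubes H' E X := by
  have hinner : ∀ Z₀, ((T Z₀).powerset.filter fun 𝒴 => cubes Z₀ ∪ 𝒴.biUnion id = X) =
      (((T Z₀).filter fun Y => Y ⊆ X).powerset.filter fun 𝒴 => cubes Z₀ ∪ 𝒴.biUnion id = X) := by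
    intro Z₀
    ext 𝒴
    simp only [Finset.mem_filter, Finset.mem_powerset]
    constructor
    · rintro ⟨h𝒴, hX⟩
      refine ⟨fun Y hY => Finset.mem_filter.2 ⟨h𝒴 hY, ?_⟩, hX⟩
      rw [← hX]
      exact (Finset.subset_biUnion_of_mem id hY).trans Finset.subset_union_right
    · rintro ⟨h𝒴, hX⟩
      exact ⟨fun Y hY => (Finset.mem_filter.1 (h𝒴 hY)).1, hX⟩
  unfold E0
  symm
  rw [Finset.sum_filter_of_ne]
  · exact Finset.sum_congr rfl fun Z₀ _ => by rw [hinner]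
  · intro Z₀ _ hne
    by_contra hZX
    apply hne
    rw [Finset.sum_eq_zero fun 𝒴 h𝒴 => ?_, mul_zero]
    exfalso
    apply hZX
    rw [← (Finset.mem_filter.1 h𝒴).2]
    exact Finset.subset_union_left

/-- **Locality of `E₀(X)`, abstract form** (p. 278 *"do not depend on Λ_{k+1} and coincide with the corresponding terms
arising from the expressions defined on the whole lattice"*): two data agreeing INSIDE `X` — the same marked domains
`Z₀` with `cubes Z₀ ⊆ X`, the same admissible supports `Y ⊆ X` for them, the same exponents `Ẽ(Y)` for `Y ⊆ X` — give
the same `E₀(X)`. [cite: Balaban1988Convergent, (3.47) p.278] -/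
theorem E0_local {D D' : Finset P} {T T' : P → Finset (Finset Cube)} (cubes : P → Finset Cube) (H' : P → ℂ)
    {E E' : Finset Cube → ℂ} (X : Finset Cube) (hD : ∀ Z₀, cubes Z₀ ⊆ X → (Z₀ ∈ D ↔ Z₀ ∈ D'))
    (hT : ∀ Z₀ ∈ D, cubes Z₀ ⊆ X → ∀ Y ⊆ X, (Y ∈ T Z₀ ↔ Y ∈ T' Z₀)) (hE : ∀ Y ⊆ X, E Y = E' Y) :
    E0 D T cubes H' E X = E0 D' T' cubes H' E' X := by
  rw [E0_restrict D, E0_restrict D']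
  have hDD : (D.filter fun Z₀ => cubes Z₀ ⊆ X) = D'.filter fun Z₀ => cubes Z₀ ⊆ X := by
    ext Z₀
    simp only [Finset.mem_filter]
    exact ⟨fun h => ⟨(hD Z₀ h.2).1 h.1, h.2⟩, fun h => ⟨(hD Z₀ h.2).2 h.1, h.2⟩⟩
  unfold E0
  rw [hDD]
  refine Finset.sum_congr rfl fun Z₀ hZ₀ => ?_
  obtain ⟨hZ₀D', hZX⟩ := Finset.mem_filter.1 hZ₀
  have hZ₀D : Z₀ ∈ D := (hD Z₀ hZX).2 hZ₀D'
  have hTT : ((T Z₀).filter fun Y => Y ⊆ X) = (T' Z₀).filter fun Y => Y ⊆ X := by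
    ext Y
    simp only [Finset.mem_filter]
    exact ⟨fun h => ⟨(hT Z₀ hZ₀D hZX Y h.2).1 h.1, h.2⟩, fun h => ⟨(hT Z₀ hZ₀D hZX Y h.2).2 h.1, h.2⟩⟩
  beta_reduce
  rw [hTT]
  congr 1
  refine Finset.sum_congr rfl fun 𝒴 h𝒴 => Finset.prod_congr rfl fun Y hY => ?_
  rw [hE Y (Finset.mem_filter.1 (Finset.mem_powerset.1 (Finset.mem_filter.1 h𝒴).1 hY)).2]

omit [DecidableEq Cube] in
/-- Sub-catalogues: if `Λ` and `Λ'` have the same polymers inside `X`, they have the same polymers inside every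
`Y ⊆ X`. [cite: Balaban1988Convergent, (3.47) p.278] -/
theorem inside_eq_of_subset [DecidableEq Cube] {Λ Λ' : Finset P} {cubes : P → Finset Cube} {X Y : Finset Cube}
    (hins : inside Λ cubes X = inside Λ' cubes X) (hYX : Y ⊆ X) : inside Λ cubes Y = inside Λ' cubes Y := by
  suffices key : ∀ Λ₁ Λ₂ : Finset P, inside Λ₁ cubes X = inside Λ₂ cubes X →
      inside Λ₁ cubes Y ⊆ inside Λ₂ cubes Y from (key Λ Λ' hins).antisymm (key Λ' Λ hins.symm)
  intro Λ₁ Λ₂ h12 Z hZ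
  obtain ⟨hZ₁, hZY⟩ := mem_inside.1 hZ
  have hZX : Z ∈ inside Λ₁ cubes X := mem_inside.2 ⟨hZ₁, hZY.trans hYX⟩
  rw [h12] at hZX
  exact mem_inside.2 ⟨(mem_inside.1 hZX).1, hZY⟩

/-- Two catalogues with the same polymers inside `Y` have the same covering families of `Y` (every member of a
covering family lies inside the union, `B13FamilySum.subset_inside_of_mem`). [cite: Balaban1988Convergent, (3.47) p.278] -/
theorem coveringFamilies_eq_of_inside_eq {Λ Λ' : Finset P} {cubes : P → Finset Cube} {Y : Finset Cube}
    (h : inside Λ cubes Y = inside Λ' cubes Y) : coveringFamilies Λ cubes Y = coveringFamilies Λ' cubes Y := by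
  suffices key : ∀ Λ₁ Λ₂ : Finset P, inside Λ₁ cubes Y = inside Λ₂ cubes Y →
      coveringFamilies Λ₁ cubes Y ⊆ coveringFamilies Λ₂ cubes Y from (key Λ Λ' h).antisymm (key Λ' Λ h.symm)
  intro Λ₁ Λ₂ h12 C hC
  have hins := subset_inside_of_mem hC
  rw [h12] at hins
  exact mem_coveringFamilies.2 ⟨fun Z hZ => (mem_inside.1 (hins hZ)).1, (mem_coveringFamilies.1 hC).2⟩

/-- The supports `Y ⊆ X` of subfamilies of two catalogues with the same polymers inside `X` are the same.
[cite: Balaban1988Convergent, (3.47) p.278] -/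
theorem mem_image_biUnion_iff_of_inside_eq {Λ Λ' : Finset P} {cubes : P → Finset Cube} {X Y : Finset Cube}
    (hins : inside Λ cubes X = inside Λ' cubes X) (hYX : Y ⊆ X) :
    (Y ∈ Λ.powerset.image fun C => C.biUnion cubes) ↔ (Y ∈ Λ'.powerset.image fun C => C.biUnion cubes) := by
  have hY := inside_eq_of_subset hins hYX
  suffices key : ∀ Λ₁ Λ₂ : Finset P, inside Λ₁ cubes Y = inside Λ₂ cubes Y →
      (Y ∈ Λ₁.powerset.image fun C => C.biUnion cubes) → (Y ∈ Λ₂.powerset.image fun C => C.biUnion cubes) from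
    ⟨key Λ Λ' hY, key Λ' Λ hY.symm⟩
  intro Λ₁ Λ₂ h12 hmem
  obtain ⟨C, hC, hCY⟩ := Finset.mem_image.1 hmem
  refine Finset.mem_image.2 ⟨C, Finset.mem_powerset.2 fun Z hZ => ?_, hCY⟩
  have hZins : Z ∈ inside Λ₁ cubes Y :=
    mem_inside.2 ⟨Finset.mem_powerset.1 hC hZ, hCY ▸ Finset.subset_biUnion_of_mem cubes hZ⟩
  rw [h12] at hZins
  exact (mem_inside.1 hZins).1

variable [DecidableEq P] (inc : P → P → Prop) [DecidableRel inc]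

/-- **`Ẽ(Λ, Y)` depends on `Λ` only through the polymers inside `Y`.** [cite: Balaban1988Convergent, (3.46) p.278] -/
theorem Etilde_local {Λ Λ' : Finset P} (cubes : P → Finset Cube) (H : P → ℂ) {Y : Finset Cube}
    (h : inside Λ cubes Y = inside Λ' cubes Y) : Etilde inc Λ cubes H Y = Etilde inc Λ' cubes H Y := by
  unfold Etilde
  rw [coveringFamilies_eq_of_inside_eq h]

/-- **p. 278, the `Λ_{k+1}`-independence of the (3.47) terms, PROVED for the polymer gas**: *"The important remark is
that the terms E₀^{(k+1)}(Λ_{k+1}, X, z) of this representation, for X ⊂ Λ_{k+1}, do not depend on Λ_{k+1}"* — if two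
catalogues `Λ`, `Λ'` of localization domains contain the same domains inside `X`, and the marked domains inside `X`
are the same, then the terms `E₀(Λ, X, b)` of `eq346`/`eq347` (supports of subfamilies touching `Z₀`, exponents
`Ẽ(Λ, Y)`) coincide. [cite: Balaban1988Convergent, (3.47) p.278] -/
theorem E0_eq_of_inside_eq (Λ Λ' D D' : Finset P) (cubes : P → Finset Cube) (H H' : P → ℂ)
    (t : P → Cube → Prop) [∀ Z₀, DecidablePred (t Z₀)] (X : Finset Cube)
    (hins : inside Λ cubes X = inside Λ' cubes X) (hD : ∀ Z₀, cubes Z₀ ⊆ X → (Z₀ ∈ D ↔ Z₀ ∈ D')) :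
    E0 D (fun Z₀ => (Λ.powerset.image fun C => C.biUnion cubes).filter fun Y => ∃ b ∈ Y, t Z₀ b) cubes H'
        (Etilde inc Λ cubes H) X =
      E0 D' (fun Z₀ => (Λ'.powerset.image fun C => C.biUnion cubes).filter fun Y => ∃ b ∈ Y, t Z₀ b) cubes H'
        (Etilde inc Λ' cubes H) X := by
  refine E0_local cubes H' X hD (fun Z₀ _ _ Y hYX => ?_) fun Y hYX =>
    Etilde_local inc cubes H (inside_eq_of_subset hins hYX)
  simp only [Finset.mem_filter]
  exact Iff.and (mem_image_biUnion_iff_of_inside_eq hins hYX) Iff.rfl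

/-- **p. 278, continued**: *"… and coincide with the corresponding terms arising from the expressions defined on the
whole lattice, i.e. in the framework of [I]"* — when every domain inside `X` belongs to `Λ` (`X ⊂ Λ_{k+1}`), the term
`E₀(Λ, X, b)` built from `Λ` (marked domains `Λ.filter p`, exponents `Ẽ(Λ, Y)`) equals the whole-catalogue term
(marked domains `univ.filter p`, exponents `B13Resummation.locE` = (I.7.13)). [cite: Balaban1988Convergent, (3.47) p.278] -/
theorem E0_eq_wholeLattice [Fintype P] (Λ : Finset P) (p : P → Prop) [DecidablePred p] (cubes : P → Finset Cube)
    (H H' : P → ℂ) (t : P → Cube → Prop) [∀ Z₀, DecidablePred (t Z₀)] (X : Finset Cube)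
    (hX : ∀ Z, cubes Z ⊆ X → Z ∈ Λ) :
    E0 (Λ.filter p) (fun Z₀ => (Λ.powerset.image fun C => C.biUnion cubes).filter fun Y => ∃ b ∈ Y, t Z₀ b)
        cubes H' (Etilde inc Λ cubes H) X =
      E0 (Finset.univ.filter p)
        (fun Z₀ => ((Finset.univ : Finset P).powerset.image fun C => C.biUnion cubes).filter
          fun Y => ∃ b ∈ Y, t Z₀ b) cubes H' (locE inc cubes H) X := by
  refine E0_eq_of_inside_eq inc Λ Finset.univ (Λ.filter p) (Finset.univ.filter p) cubes H H' t X ?_ ?_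
  · ext Z
    simp only [mem_inside, Finset.mem_univ, true_and]
    exact ⟨fun h => h.2, fun h => ⟨hX Z h, h⟩⟩
  · intro Z₀ hZ₀
    simp only [Finset.mem_filter, Finset.mem_univ, true_and]
    exact ⟨fun h => h.2, fun h => ⟨hX Z₀ hZ₀, h⟩⟩

end Locality347

/-! ## Part I (v1.3, append-only). The kernel bound of Part G INSTANTIATED FOR THE WINDOW MODEL: the geometric
inputs — tree-length subadditivity over the supports touching `Z₀`, the (1.26)-summability of the touching supports
and of the marked domains, the volume bound (2.30) — DISCHARGED by the tree-length library (`TreeLength`,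
`B13Ineq232TreeLength`, `TreeLengthCubeSystem`); the analytic inputs (decay of `H′`, decay/smallness of `Ẽ(Λ,Y)` or of
`H`, the Kotecký–Preiss condition) remain hypotheses -/

section Prune347

variable {P Cube : Type*} [DecidableEq Cube]

/-- Supports with vanishing exponent `Ẽ(Y) = 0` carry the Mayer factor `e^0 − 1 = 0`: the index sets `T Z₀` of
`E₀` may be pruned to any predicate off which `Ẽ` vanishes. [cite: Balaban1988Convergent, (3.47) p.278] -/
theorem E0_filter_support (D : Finset P) (T : P → Finset (Finset Cube)) (cubes : P → Finset Cube) (H' : P → ℂ)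
    (E : Finset Cube → ℂ) (p : Finset Cube → Prop) [DecidablePred p]
    (hp : ∀ Z₀ ∈ D, ∀ Y ∈ T Z₀, ¬ p Y → E Y = 0) (X : Finset Cube) :
    E0 D T cubes H' E X = E0 D (fun Z₀ => (T Z₀).filter p) cubes H' E X := by
  unfold E0
  refine Finset.sum_congr rfl fun Z₀ hZ₀ => ?_
  congr 1
  symm
  refine Finset.sum_subset (fun 𝒴 h𝒴 => ?_) fun 𝒴 h𝒴 hn => ?_
  · obtain ⟨h𝒴T, hX⟩ := Finset.mem_filter.1 h𝒴
    exact Finset.mem_filter.2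
      ⟨Finset.mem_powerset.2 ((Finset.mem_powerset.1 h𝒴T).trans (Finset.filter_subset _ _)), hX⟩
  · obtain ⟨h𝒴T, hX⟩ := Finset.mem_filter.1 h𝒴
    have h𝒴T' := Finset.mem_powerset.1 h𝒴T
    have hnot : ¬ 𝒴 ⊆ (T Z₀).filter p := fun h =>
      hn (Finset.mem_filter.2 ⟨Finset.mem_powerset.2 h, hX⟩)
    obtain ⟨Y, hY𝒴, hY⟩ := Finset.not_subset.1 hnot
    have hpY : ¬ p Y := fun h => hY (Finset.mem_filter.2 ⟨h𝒴T' hY𝒴, h⟩)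
    refine Finset.prod_eq_zero hY𝒴 ?_
    rw [hp Z₀ hZ₀ Y (h𝒴T' hY𝒴) hpY, neg_zero, Complex.exp_zero, sub_self]

omit [DecidableEq Cube] in
/-- Counting through a cover: if every `Y ∈ S` contains some `q ∈ Q`, then `Σ_{Y∈S} f(Y) ≤ Σ_{q∈Q} Σ_{Y∈S, q∈Y} f(Y)`
for `f ≥ 0`. [folklore] -/
private theorem sum_le_sum_sum_filter_of_cover {κ' : Type*} (S : Finset (Finset Cube)) (Q : Finset κ') (r : κ' → Cube)
    [DecidableEq Cube] (f : Finset Cube → ℝ) (hf : ∀ Y ∈ S, 0 ≤ f Y) (hcov : ∀ Y ∈ S, ∃ q ∈ Q, r q ∈ Y) :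
    ∑ Y ∈ S, f Y ≤ ∑ q ∈ Q, ∑ Y ∈ S with r q ∈ Y, f Y := by
  calc ∑ Y ∈ S, f Y ≤ ∑ Y ∈ S, ((Q.filter fun q => r q ∈ Y).card : ℝ) * f Y := by
        refine Finset.sum_le_sum fun Y hY => ?_
        obtain ⟨q, hq, hr⟩ := hcov Y hY
        have h1 : (1 : ℝ) ≤ (Q.filter fun q => r q ∈ Y).card := by
          exact_mod_cast Finset.card_pos.2 ⟨q, Finset.mem_filter.2 ⟨hq, hr⟩⟩
        nlinarith [hf Y hY]
    _ = ∑ Y ∈ S, ∑ q ∈ Q, if r q ∈ Y then f Y else 0 := by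
        refine Finset.sum_congr rfl fun Y _ => ?_
        rw [← Finset.sum_filter, Finset.sum_const, nsmul_eq_mul]
    _ = ∑ q ∈ Q, ∑ Y ∈ S, if r q ∈ Y then f Y else 0 := Finset.sum_comm
    _ = ∑ q ∈ Q, ∑ Y ∈ S with r q ∈ Y, f Y :=
        Finset.sum_congr rfl fun q _ => by rw [Finset.sum_filter]

end Prune347

section WindowBound347

open Literature.MathematicalPhysics.QuantumFieldTheory.Balaban1983to89.B13ScaleTransfer
  (Pt Adj FaceConnected Linked StepIn linked_of_stepIn)
open Literature.MathematicalPhysics.QuantumFieldTheory.Balaban1983to89.B13Ineq232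
  (faceConnected_union faceConnected_insert linked_refl)
open Literature.MathematicalPhysics.QuantumFieldTheory.Balaban1983to89.B13Ineq232TreeLength (treeLen_union_le)
open Literature.MathematicalPhysics.QuantumFieldTheory.Balaban1983to89.TreeLength
  (treeLen treeLen_nonneg treeLen_le_card_sdiff_add)
open Literature.MathematicalPhysics.QuantumFieldTheory.Balaban1983to89.TreeLengthCubeSystem
  (Dom Cell cellsOf mem_cellsOf Touch touch_refl touch_symm reach mem_reach card_reach_le loc_of_touch sys geometry
    sum_exp_treeLen_le ineq227_cells)
open Literature.MathematicalPhysics.QuantumFieldTheory.Balaban1983to89.B12TreeDecay (kappa₀ K₀ K₀_pos kappa₀_nonneg)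

variable {d : ℕ} (B : Finset (Pt d))

/-- A family of cubes of the window as a family of cube indices. [folklore] -/
def pts (Y : Finset (Cell B)) : Finset (Pt d) := Y.image Subtype.val

/-- Membership in `pts`. [folklore] -/
private theorem mem_pts {Y : Finset (Cell B)} {x : Pt d} : x ∈ pts B Y ↔ ∃ h : x ∈ B, ⟨x, h⟩ ∈ Y := by
  unfold pts
  rw [Finset.mem_image]
  constructor
  · rintro ⟨c, hc, rfl⟩
    exact ⟨c.2, hc⟩
  · rintro ⟨h, hc⟩
    exact ⟨⟨x, h⟩, hc, rfl⟩

/-- `pts Y ⊆ B`. [folklore] -/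
private theorem pts_subset (Y : Finset (Cell B)) : pts B Y ⊆ B := fun _ hx => ((mem_pts B).1 hx).1

/-- A cube of `Y` is an index of `pts Y`. [folklore] -/
private theorem val_mem_pts {Y : Finset (Cell B)} {c : Cell B} (hc : c ∈ Y) : c.1 ∈ pts B Y :=
  (mem_pts B).2 ⟨c.2, hc⟩

/-- The indices of the cubes of a domain are the domain. [folklore] -/
private theorem pts_cellsOf (Z : Dom B) : pts B (cellsOf B Z.1) = Z.1 := by
  ext x
  rw [mem_pts]
  constructor
  · rintro ⟨h, hc⟩
    exact mem_cellsOf.1 hc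
  · intro hx
    exact ⟨Z.2.1 hx, mem_cellsOf.2 hx⟩

/-- The cubes of `pts Y` are `Y`. [folklore] -/
private theorem cellsOf_pts (Y : Finset (Cell B)) : cellsOf B (pts B Y) = Y := by
  ext c
  rw [mem_cellsOf, mem_pts]
  constructor
  · rintro ⟨h, hc⟩
    exact hc
  · intro hc
    exact ⟨c.2, hc⟩

/-- `pts` is injective. [folklore] -/
private theorem pts_injective : Function.Injective (pts B) := fun Y Y' h => by
  rw [← cellsOf_pts B Y, ← cellsOf_pts B Y', h]

/-- `pts` of a union. [folklore] -/
private theorem pts_union (Y Y' : Finset (Cell B)) : pts B (Y ∪ Y') = pts B Y ∪ pts B Y' :=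
  Finset.image_union _ _

/-- `pts` of a union of a family. [folklore] -/
private theorem pts_biUnion (𝒴 : Finset (Finset (Cell B))) : pts B (𝒴.biUnion id) = 𝒴.biUnion (pts B) := by
  ext x
  simp only [mem_pts, Finset.mem_biUnion, id]
  constructor
  · rintro ⟨h, Y, hY, hx⟩
    exact ⟨Y, hY, h, hx⟩
  · rintro ⟨Y, hY, h, hx⟩
    exact ⟨h, Y, hY, hx⟩

/-- `pts Y` is non-empty iff `Y` is. [folklore] -/
private theorem pts_nonempty_iff {Y : Finset (Cell B)} : (pts B Y).Nonempty ↔ Y.Nonempty := Finset.image_nonempty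

/-- The size of a family of cubes of the window: the tree length `d_k` of its index set (`TreeLength.treeLen`).
[cite: Balaban1988Convergent, (2.42) p.261] -/
noncomputable def dW (Y : Finset (Cell B)) : ℝ := treeLen (pts B Y)

/-- The size of the footprint of a domain is its tree length. [folklore] -/
private theorem dW_cellsOf (Z : Dom B) : dW B (cellsOf B Z.1) = treeLen Z.1 := by
  rw [dW, pts_cellsOf]

/-- The cube families carrying non-zero exponents `Ẽ(Λ, Y)`: the LOCALIZATION DOMAINS of the window — non-empty and
face-connected ([Balaban1987RG1] p. 257 *"connected family"* of cubes, as `TreeLengthCubeSystem.IsDom`), read on a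
family of cubes of `B` through its index set. [cite: Balaban1987RG1, §0 p.257] -/
def Good (Y : Finset (Cell B)) : Prop := (pts B Y).Nonempty ∧ FaceConnected (pts B Y)

/-- **The support of a cluster is a localization domain**: the union of the footprints of a non-empty family of domains
which is a cluster for `Touch B` (not decomposable into two mutually non-touching parts) is non-empty and face-connected.
[cite: Balaban1988RG2Cluster, (2.13) p.14] -/
theorem good_biUnion_of_isPolymerCluster [DecidableEq (Dom B)] {C : Finset (Dom B)} (hC : IsPolymerCluster (Touch B) C)
    (hne : C.Nonempty) : Good B (C.biUnion fun Z => cellsOf B Z.1) := by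
  classical
  set U : Finset (Pt d) := pts B (C.biUnion fun Z => cellsOf B Z.1) with hU
  have hmemU : ∀ {x : Pt d}, x ∈ U ↔ ∃ Z ∈ C, x ∈ (Z : Dom B).1 := by
    intro x
    rw [hU, mem_pts]
    constructor
    · rintro ⟨h, hc⟩
      obtain ⟨Z, hZ, hx⟩ := Finset.mem_biUnion.1 hc
      exact ⟨Z, hZ, mem_cellsOf.1 hx⟩
    · rintro ⟨Z, hZ, hx⟩
      exact ⟨Z.2.1 hx, Finset.mem_biUnion.2 ⟨Z, hZ, mem_cellsOf.2 hx⟩⟩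
  have hZU : ∀ Z ∈ C, (Z : Dom B).1 ⊆ U := fun Z hZ x hx => hmemU.2 ⟨Z, hZ, hx⟩
  obtain ⟨Z₁, hZ₁⟩ := hne
  obtain ⟨x₁, hx₁⟩ := Z₁.2.2.1
  refine ⟨⟨x₁, hmemU.2 ⟨Z₁, hZ₁, hx₁⟩⟩, ?_⟩
  -- every cube of `U` is linked inside `U` to `x₁`
  suffices key : ∀ Z ∈ C, ∀ y ∈ (Z : Dom B).1, Linked U x₁ y by
    intro x hx y hy
    obtain ⟨Zx, hZx, hxZ⟩ := hmemU.1 hx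
    obtain ⟨Zy, hZy, hyZ⟩ := hmemU.1 hy
    exact (key Zx hZx x hxZ).symm.trans (key Zy hZy y hyZ)
  -- the sub-family of domains all of whose cubes are linked to `x₁` is all of `C` (cluster property)
  set C₁ := C.filter fun Z => ∀ y ∈ (Z : Dom B).1, Linked U x₁ y with hC₁
  have hspread : ∀ Z ∈ C, ∀ y₀ ∈ (Z : Dom B).1, Linked U x₁ y₀ → ∀ y ∈ Z.1, Linked U x₁ y :=
    fun Z hZ y₀ hy₀ h y hy => h.trans ((Z.2.2.2 y₀ hy₀ y hy).mono (hZU Z hZ))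
  have hZ₁C₁ : Z₁ ∈ C₁ :=
    Finset.mem_filter.2 ⟨hZ₁, hspread Z₁ hZ₁ x₁ hx₁ (linked_refl U x₁)⟩
  by_contra hnot
  have hdiff : (C \ C₁).Nonempty := by
    by_contra hempty
    apply hnot
    intro Z hZ y hy
    have hZC₁ : Z ∈ C₁ := by
      by_contra hZC₁
      exact hempty ⟨Z, Finset.mem_sdiff.2 ⟨hZ, hZC₁⟩⟩
    exact (Finset.mem_filter.1 hZC₁).2 y hy
  obtain ⟨W₁, hW₁, W₂, hW₂, hW⟩ := hC C₁ (Finset.filter_subset _ _) ⟨Z₁, hZ₁C₁⟩ hdiff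
  obtain ⟨a, ha, b, hb, hab⟩ := hW
  obtain ⟨hW₁C, hW₁l⟩ := Finset.mem_filter.1 hW₁
  obtain ⟨hW₂C, hW₂n⟩ := Finset.mem_sdiff.1 hW₂
  have ha1 : Linked U x₁ a.1 := hW₁l a.1 (mem_cellsOf.1 ha)
  have hb1 : Linked U x₁ b.1 := by
    rcases hab with hab | hab
    · rw [← hab]
      exact ha1
    · exact ha1.trans (linked_of_stepIn ⟨hZU W₁ hW₁C (mem_cellsOf.1 ha), hZU W₂ hW₂C (mem_cellsOf.1 hb), hab⟩)
  exact hW₂n (Finset.mem_filter.2 ⟨hW₂C, hspread W₂ hW₂C b.1 (mem_cellsOf.1 hb) hb1⟩)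

open Classical in
/-- **`Ẽ(Λ, Y) = 0` off the localization domains** (Kotecký–Preiss): under the KP condition the truncated functional
vanishes on non-clusters (`truncatedWeight_eq_zero_of_kp`), and the support of a cluster is a localization domain
(`good_biUnion_of_isPolymerCluster`); so `locE … Y = 0` for every non-empty `Y` that is not one.
[cite: Balaban1988Convergent, (3.46) p.278] -/
theorem locE_eq_zero_of_not_good {H : Dom B → ℂ} {a : Dom B → ℝ} (hKP : IsKPVolume (Touch B) H a Finset.univ)
    {Y : Finset (Cell B)} (hYne : Y.Nonempty) (hY : ¬ Good B Y) :
    locE (Touch B) (fun Z : Dom B => cellsOf B Z.1) H Y = 0 := by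
  classical
  haveI : Std.Refl (Touch B) := ⟨touch_refl B⟩
  haveI : Std.Symm (Touch B) := ⟨touch_symm B⟩
  refine Finset.sum_eq_zero fun C hC => ?_
  obtain ⟨-, hCY⟩ := B13FamilySum.mem_coveringFamilies.1 hC
  refine truncatedWeight_eq_zero_of_kp hKP (Finset.subset_univ C) fun hcl => hY ?_
  have hCne : C.Nonempty := by
    rw [Finset.nonempty_iff_ne_empty]
    rintro rfl
    rw [Finset.biUnion_empty] at hCY
    exact hYne.ne_empty hCY.symm
  rw [← hCY]
  exact good_biUnion_of_isPolymerCluster B hcl hCne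

/-- **Tree-length subadditivity over the supports touching `Z₀`** ((2.27)/(2.32)-type, for the formalised `d_k`): for
localization domains `Y ∈ 𝒴`, each touching `Z₀` along a wall or a cube, `Z₀ ∪ ⋃𝒴` is face-connected and
`d(Z₀ ∪ ⋃𝒴) ≤ d(Z₀) + Σ_{Y∈𝒴} (d(Y) + 2)` (join through a common cube at cost 1, `B13Ineq232TreeLength.treeLen_union_le`;
through a wall at cost 2, adjoining the touching cube first, `TreeLength.treeLen_le_card_sdiff_add`).
[cite: Balaban1988RG2Cluster, (2.27) p.18] -/
theorem treeLen_union_touching_le (Z₀ : Dom B) (𝒴 : Finset (Finset (Cell B))) (hgood : ∀ Y ∈ 𝒴, Good B Y)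
    (htouch : ∀ Y ∈ 𝒴, TouchesCells B Z₀ Y) :
    FaceConnected (Z₀.1 ∪ 𝒴.biUnion (pts B)) ∧
      treeLen (Z₀.1 ∪ 𝒴.biUnion (pts B)) ≤ treeLen Z₀.1 + ∑ Y ∈ 𝒴, (treeLen (pts B Y) + 2) := by
  classical
  induction 𝒴 using Finset.induction_on with
  | empty =>
    rw [Finset.biUnion_empty, Finset.union_empty, Finset.sum_empty, add_zero]
    exact ⟨Z₀.2.2.2, le_rfl⟩
  | @insert Y 𝒴 hY𝒴 ih =>
    obtain ⟨ihc, ihl⟩ := ih (fun Y' hY' => hgood Y' (Finset.mem_insert_of_mem hY'))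
      (fun Y' hY' => htouch Y' (Finset.mem_insert_of_mem hY'))
    set S : Finset (Pt d) := Z₀.1 ∪ 𝒴.biUnion (pts B) with hS
    obtain ⟨hYne, hYc⟩ := hgood Y (Finset.mem_insert_self Y 𝒴)
    obtain ⟨b, hb, a, ha, hab⟩ := htouch Y (Finset.mem_insert_self Y 𝒴)
    have haS : a.1 ∈ S := Finset.mem_union_left _ (mem_cellsOf.1 ha)
    have hbY : b.1 ∈ pts B Y := val_mem_pts B hb
    have hSne : S.Nonempty := ⟨a.1, haS⟩
    have hnew : Z₀.1 ∪ (insert Y 𝒴).biUnion (pts B) = S ∪ pts B Y := by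
      rw [Finset.biUnion_insert, hS, Finset.union_comm (pts B Y), ← Finset.union_assoc]
    rw [hnew, Finset.sum_insert hY𝒴]
    -- join `S` and `pts Y` at cost ≤ 2
    suffices hjoin : FaceConnected (S ∪ pts B Y) ∧ treeLen (S ∪ pts B Y) ≤ treeLen S + treeLen (pts B Y) + 2 by
      exact ⟨hjoin.1, by linarith [hjoin.2]⟩
    rcases hab with hab | hab
    · -- a common cube
      have haY : a.1 ∈ pts B Y := by rw [hab]; exact hbY
      exact ⟨faceConnected_union ihc hYc ⟨a.1, Finset.mem_inter.2 ⟨haS, haY⟩⟩,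
        by linarith [treeLen_union_le hSne hYne ihc hYc ⟨a.1, Finset.mem_inter.2 ⟨haS, haY⟩⟩]⟩
    · -- a common wall: adjoin the cube `a` to `Y` first
      set Y' : Finset (Pt d) := insert a.1 (pts B Y) with hY'
      have hY'c : FaceConnected Y' := faceConnected_insert hYc hbY hab.symm
      have hY'ne : Y'.Nonempty := ⟨a.1, Finset.mem_insert_self _ _⟩
      have hSY' : S ∪ pts B Y = S ∪ Y' := by
        rw [hY', Finset.union_insert, Finset.insert_eq_of_mem (Finset.mem_union_left _ haS)]
      have hlenY' : treeLen Y' ≤ treeLen (pts B Y) + 1 := by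
        have h := treeLen_le_card_sdiff_add hYne (Finset.subset_insert _ _) hYc hY'c
        have hcard : ((Y' \ pts B Y).card : ℝ) ≤ 1 := by
          have hsub : Y' \ pts B Y ⊆ {a.1} := fun x hx => by
            obtain ⟨hx1, hx2⟩ := Finset.mem_sdiff.1 hx
            rcases Finset.mem_insert.1 hx1 with hx1 | hx1
            · exact Finset.mem_singleton.2 hx1
            · exact absurd hx1 hx2
          exact_mod_cast (Finset.card_le_card hsub).trans (Finset.card_singleton _).le
        linarith
      rw [hSY']
      have hI : (S ∩ Y').Nonempty := ⟨a.1, Finset.mem_inter.2 ⟨haS, Finset.mem_insert_self _ _⟩⟩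
      have hj := treeLen_union_le hSne hY'ne ihc hY'c hI
      exact ⟨faceConnected_union ihc hY'c hI, by linarith⟩

/-- **(1.26)-summability of the localization domains touching `Z₀`**: for κ′ ≥ κ₀(4·2^d, 2d), the sum of
`e^{−κ′ d(Y)}` over any family of distinct localization domains `Y` (as cube families of the window) touching `Z₀` is
`≤ (2d+1) K₀ · #cubes Z₀` (each such `Y` contains a cube of the reach of `Z₀`, `TreeLengthCubeSystem.sum_exp_treeLen_le`
per cube, `card_reach_le`). [cite: Balaban1988RG2Cluster, (1.26) p.8] -/
theorem sum_exp_good_touching_le (Z₀ : Dom B) (S : Finset (Finset (Cell B))) (hgood : ∀ Y ∈ S, Good B Y)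
    (htouch : ∀ Y ∈ S, TouchesCells B Z₀ Y) {κ' : ℝ} (hκ' : kappa₀ (4 * 2 ^ d) (2 * d) ≤ κ') :
    ∑ Y ∈ S, Real.exp (-(κ' * dW B Y)) ≤
      (2 * (d : ℝ) + 1) * K₀ (4 * 2 ^ d) (2 * d) * ((cellsOf B Z₀.1).card : ℝ) := by
  classical
  have hcov : ∀ Y ∈ S, ∃ q ∈ reach B Z₀, (fun q : Cell B => q) q ∈ Y := by
    intro Y hY
    obtain ⟨b, hb, a, ha, hab⟩ := htouch Y hY
    refine ⟨b, mem_reach.2 ⟨a, ha, ?_⟩, hb⟩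
    rcases hab with hab | hab
    · exact Or.inl hab.symm
    · exact Or.inr hab
  refine (sum_le_sum_sum_filter_of_cover S (reach B Z₀) (fun q : Cell B => q) _
    (fun Y _ => (Real.exp_nonneg _)) hcov).trans ?_
  have hq : ∀ q ∈ reach B Z₀, ∑ Y ∈ S with q ∈ Y, Real.exp (-(κ' * dW B Y)) ≤ K₀ (4 * 2 ^ d) (2 * d) := by
    intro q _
    have hinj : ∀ Y ∈ S.filter (fun Y => q ∈ Y), ∀ Y' ∈ S.filter (fun Y => q ∈ Y), pts B Y = pts B Y' → Y = Y' :=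
      fun Y _ Y' _ h => pts_injective B h
    calc ∑ Y ∈ S with q ∈ Y, Real.exp (-(κ' * dW B Y))
        = ∑ X ∈ (S.filter fun Y => q ∈ Y).image (pts B), Real.exp (-κ' * treeLen X) := by
          rw [Finset.sum_image hinj]
          exact Finset.sum_congr rfl fun Y _ => by rw [dW, neg_mul]
      _ ≤ ∑ X ∈ B.powerset.filter (fun X => q.1 ∈ X ∧ FaceConnected X), Real.exp (-κ' * treeLen X) := by
          refine Finset.sum_le_sum_of_subset_of_nonneg (fun X hX => ?_) fun _ _ _ => Real.exp_nonneg _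
          obtain ⟨Y, hY, rfl⟩ := Finset.mem_image.1 hX
          obtain ⟨hYS, hqY⟩ := Finset.mem_filter.1 hY
          exact Finset.mem_filter.2
            ⟨Finset.mem_powerset.2 (pts_subset B Y), val_mem_pts B hqY, (hgood Y hYS).2⟩
      _ ≤ K₀ (4 * 2 ^ d) (2 * d) := sum_exp_treeLen_le B q.2 hκ'
  calc ∑ q ∈ reach B Z₀, ∑ Y ∈ S with q ∈ Y, Real.exp (-(κ' * dW B Y))
      ≤ ∑ q ∈ reach B Z₀, K₀ (4 * 2 ^ d) (2 * d) := Finset.sum_le_sum hq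
    _ = ((reach B Z₀).card : ℝ) * K₀ (4 * 2 ^ d) (2 * d) := by rw [Finset.sum_const, nsmul_eq_mul]
    _ ≤ (2 * (d : ℝ) + 1) * ((cellsOf B Z₀.1).card : ℝ) * K₀ (4 * 2 ^ d) (2 * d) :=
        mul_le_mul_of_nonneg_right (card_reach_le B Z₀) (K₀_pos _ _).le
    _ = (2 * (d : ℝ) + 1) * K₀ (4 * 2 ^ d) (2 * d) * ((cellsOf B Z₀.1).card : ℝ) := by ring

/-- **(1.26) for the marked domains**: `Σ_{Z₀ ∋ c} e^{−κ₂ d(Z₀)} ≤ K₀(4·2^d, 2d)` for κ₂ ≥ κ₀(4·2^d, 2d)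
(`TreeLengthCubeSystem.sum_exp_treeLen_le`). [cite: Balaban1988RG2Cluster, (1.26) p.8] -/
theorem sum_exp_domsWith_le (c : Cell B) {κ₂ : ℝ} (hκ₂ : kappa₀ (4 * 2 ^ d) (2 * d) ≤ κ₂) :
    ∑ Z₀ ∈ domsWith B c, Real.exp (-(κ₂ * dW B (cellsOf B Z₀.1))) ≤ K₀ (4 * 2 ^ d) (2 * d) := by
  classical
  have hinj : ∀ Z ∈ domsWith B c, ∀ Z' ∈ domsWith B c, (Z : Dom B).1 = Z'.1 → Z = Z' :=
    fun Z _ Z' _ h => Subtype.ext h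
  calc ∑ Z₀ ∈ domsWith B c, Real.exp (-(κ₂ * dW B (cellsOf B Z₀.1)))
      = ∑ X ∈ (domsWith B c).image (fun Z : Dom B => Z.1), Real.exp (-κ₂ * treeLen X) := by
        rw [Finset.sum_image hinj]
        exact Finset.sum_congr rfl fun Z _ => by rw [dW_cellsOf, neg_mul]
    _ ≤ ∑ X ∈ B.powerset.filter (fun X => c.1 ∈ X ∧ FaceConnected X), Real.exp (-κ₂ * treeLen X) := by
        refine Finset.sum_le_sum_of_subset_of_nonneg (fun X hX => ?_) fun _ _ _ => Real.exp_nonneg _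
        obtain ⟨Z, hZ, rfl⟩ := Finset.mem_image.1 hX
        exact Finset.mem_filter.2
          ⟨Finset.mem_powerset.2 Z.2.1, mem_cellsOf.1 ((mem_domsWith B).1 hZ), Z.2.2.2⟩
    _ ≤ K₀ (4 * 2 ^ d) (2 * d) := sum_exp_treeLen_le B c.2 hκ₂

/-- **The volume bound (2.30) for the window**: `#cubes Z₀ ≤ 4·2^d (1 + d(Z₀))`
(`TreeLengthCubeSystem.geometry.volBound`). [cite: Balaban1988RG2Cluster, (2.30) p.18] -/
theorem card_cellsOf_le_dW (Z₀ : Dom B) : ((cellsOf B Z₀.1).card : ℝ) ≤ 4 * 2 ^ d * (1 + dW B (cellsOf B Z₀.1)) := by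
  rw [dW_cellsOf]
  exact (geometry B).volBound Z₀ (Finset.mem_univ _)

open Classical in
/-- **THE (2.42)-TYPE BOUND ON THE (3.47) TERMS IN THE WINDOW MODEL** (p. 278 *"The terms of the sum above satisfy the
bounds (2.42)"*), the kernel theorem `norm_E0_le` with its geometric inputs discharged: for the polymer gas of the
window `B` (domains `Dom B`, incompatibility `Touch B`, footprints `cellsOf`) under the Kotecký–Preiss condition for the
denominator activities `H`, IF the marked activities decay, `‖H′(Z₀)‖ ≤ A′e^{−R d(Z₀)}`, and the exponents are small
with decay on the localization domains, `‖E(Y)‖ ≤ ε e^{−r d(Y)}` (`E = B13Resummation.locE`; `norm_locE_window_le`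
derives this from the decay of `H`), with `ε ≤ 1`, `r − κ ≥ κ₀(4·2^d,2d)`, `κ₂ ≥ κ₀(4·2^d,2d)` and the rate condition
`κ + 2εe^{2κ}(2d+1)K₀·4·2^d + κ₂ ≤ R`, THEN the terms of `eq347_window` obey
`‖E₀(X, c)‖ ≤ A′ e^{2εe^{2κ}(2d+1)K₀·4·2^d} K₀ · e^{−κ d(X)}`, `d` = the tree length of the cube family `X`
(`dW`), `K₀ = K₀(4·2^d, 2d)` of (1.26). [cite: Balaban1988Convergent, (3.47) p.278] -/
theorem norm_E0_window_le {H H' : Dom B → ℂ} {a : Dom B → ℝ} (hKP : IsKPVolume (Touch B) H a Finset.univ)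
    (c : Cell B) {A' R ε r κ κ₂ : ℝ} (hA' : 0 ≤ A') (hε : 0 ≤ ε) (hε1 : ε ≤ 1) (hκ : 0 ≤ κ) (hr : 0 ≤ r)
    (hrκ : kappa₀ (4 * 2 ^ d) (2 * d) ≤ r - κ) (hκ₂ : kappa₀ (4 * 2 ^ d) (2 * d) ≤ κ₂)
    (hH' : ∀ Z₀ : Dom B, ‖H' Z₀‖ ≤ A' * Real.exp (-(R * treeLen Z₀.1)))
    (hE : ∀ Y : Finset (Cell B), Good B Y →
      ‖locE (Touch B) (fun Z : Dom B => cellsOf B Z.1) H Y‖ ≤ ε * Real.exp (-(r * dW B Y)))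
    (hrate : κ + 2 * ε * Real.exp (κ * 2) * ((2 * (d : ℝ) + 1) * K₀ (4 * 2 ^ d) (2 * d)) * (4 * 2 ^ d) + κ₂ ≤ R)
    (X : Finset (Cell B)) :
    ‖E0 (domsWith B c)
        (fun Z₀ => ((Finset.univ : Finset (Dom B)).powerset.image
          fun C => C.biUnion fun X => cellsOf B X.1).filter (TouchesCells B Z₀))
        (fun Z : Dom B => cellsOf B Z.1) H' (locE (Touch B) (fun Z : Dom B => cellsOf B Z.1) H) X‖ ≤
      A' * Real.exp (2 * ε * Real.exp (κ * 2) * ((2 * (d : ℝ) + 1) * K₀ (4 * 2 ^ d) (2 * d)) * (4 * 2 ^ d)) *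
        K₀ (4 * 2 ^ d) (2 * d) * Real.exp (-(κ * dW B X)) := by
  have hTne : ∀ Z₀ : Dom B, ∀ Y ∈ ((Finset.univ : Finset (Dom B)).powerset.image
      fun C => C.biUnion fun X => cellsOf B X.1).filter (TouchesCells B Z₀), Y.Nonempty := by
    intro Z₀ Y hY
    obtain ⟨b, hb, -⟩ := (Finset.mem_filter.1 hY).2
    exact ⟨b, hb⟩
  rw [E0_filter_support (p := Good B) _ _ _ _ _
    (hp := fun Z₀ _ Y hY hng => locE_eq_zero_of_not_good B hKP (hTne Z₀ Y hY) hng)]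
  have hK : 0 ≤ (2 * (d : ℝ) + 1) * K₀ (4 * 2 ^ d) (2 * d) := mul_nonneg (by positivity) (K₀_pos _ _).le
  refine norm_E0_le (R := R) (r := r) (κ₂ := κ₂) (domsWith B c) _ (fun Z : Dom B => cellsOf B Z.1) H' _ (dW B)
    (fun Y => treeLen_nonneg _) hκ hε hε1 hr hK (by positivity) hA' ?_ ?_ ?_ ?_ ?_ ?_ hrate X
  · -- subadditivity over the touching localization domains
    intro Z₀ _ 𝒴 h𝒴
    have hgood : ∀ Y ∈ 𝒴, Good B Y := fun Y hY => (Finset.mem_filter.1 (h𝒴 hY)).2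
    have htouch : ∀ Y ∈ 𝒴, TouchesCells B Z₀ Y := fun Y hY =>
      (Finset.mem_filter.1 (Finset.mem_filter.1 (h𝒴 hY)).1).2
    have h := (treeLen_union_touching_le B Z₀ 𝒴 hgood htouch).2
    simp only [dW]
    rw [pts_union, pts_biUnion, pts_cellsOf]
    exact h
  · intro Z₀ _ Y hY
    exact hE Y (Finset.mem_filter.1 hY).2
  · intro Z₀ _
    refine sum_exp_good_touching_le B Z₀ _ (fun Y hY => (Finset.mem_filter.1 hY).2)
      (fun Y hY => (Finset.mem_filter.1 (Finset.mem_filter.1 hY).1).2) hrκ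
  · intro Z₀ _
    rw [dW_cellsOf]
    exact hH' Z₀
  · intro Z₀ _
    exact card_cellsOf_le_dW B Z₀
  · exact sum_exp_domsWith_le B c hκ₂

/-- **The exponents `E(Y)` on the localization domains of the window are small with tree decay** when the activities
`H` decay — `B13Resummation.norm_locE_le` ((2.13)–(2.29) of [Balaban1988RG2Cluster], Kotecký–Preiss + (1.26) + (2.27)
+ (2.30)) with every geometric hypothesis discharged by `TreeLengthCubeSystem.geometry` / `ineq227_cells`:
for `‖H(Z)‖ ≤ A e^{−R d(Z)}`, `R ≥ r₁ + 2κ₀ + 1 + 4·2^d τ`, `A e^{b + 4·2^d τ} K₀ (2d+1) ≤ τ`, `b ≥ 5r₁`,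
`‖E(Y)‖ ≤ τ·4·2^d·K₀·e^{−b}·e^{−r₁ d(Y)}` on every localization domain `Y`. [cite: Balaban1988Convergent, (3.46) p.278] -/
theorem norm_locE_window_le [DecidableEq (Dom B)] [DecidableRel (Touch B)] {H : Dom B → ℂ} {A R r₁ b τ : ℝ} (hA : 0 ≤ A) (hτ : 0 ≤ τ) (hr₁ : 0 ≤ r₁)
    (hb : r₁ * 5 ≤ b) (hH : ∀ Z : Dom B, ‖H Z‖ ≤ A * Real.exp (-(R * treeLen Z.1)))
    (hrate : r₁ + 2 * kappa₀ (4 * 2 ^ d) (2 * d) + 1 + τ * (4 * 2 ^ d) ≤ R)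
    (hsmall : A * Real.exp (b + τ * (4 * 2 ^ d)) * K₀ (4 * 2 ^ d) (2 * d) * (2 * (d : ℝ) + 1) ≤ τ)
    {Y : Finset (Cell B)} (hY : Good B Y) :
    ‖locE (Touch B) (fun Z : Dom B => cellsOf B Z.1) H Y‖ ≤
      τ * (4 * 2 ^ d) * K₀ (4 * 2 ^ d) (2 * d) * Real.exp (-b) * Real.exp (-(r₁ * dW B Y)) := by
  classical
  haveI : Std.Refl (Touch B) := ⟨touch_refl B⟩
  haveI : Std.Symm (Touch B) := ⟨touch_symm B⟩
  have hYdom : TreeLengthCubeSystem.IsDom B (pts B Y) := ⟨pts_subset B Y, hY.1, hY.2⟩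
  have h227 := ineq227_cells B ⟨pts B Y, hYdom⟩
  rw [cellsOf_pts] at h227
  exact B13Resummation.norm_locE_le (Touch B) (reach := reach B) (d := fun Z : Dom B => treeLen Z.1)
    (fun Z Z' h => loc_of_touch h) (card_reach_le B) (fun Z => treeLen_nonneg _) hA (K₀_pos _ _).le
    (by positivity) hτ (kappa₀_nonneg (by positivity) _) hr₁ (by norm_num) hb (fun Z _ => hH Z)
    (geometry B).ineq126 (geometry B).volBound h227 hrate hsmall ((pts_nonempty_iff B).1 hY.1)

open Classical in
/-- **The (2.42)-type bound on the (3.47) terms from activity decay alone** (`norm_E0_window_le` ∘ `norm_locE_window_le`):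
in the window polymer gas under the Kotecký–Preiss condition, if `‖H(Z)‖ ≤ A e^{−R d(Z)}` and `‖H′(Z₀)‖ ≤ A′e^{−R′d(Z₀)}`
with the rate and smallness conditions listed (all constants explicit: κ₀ = κ₀(4·2^d,2d), K₀ = K₀(4·2^d,2d) of (1.26),
c₁ = 4·2^d of (2.30), ν = 2d+1, joining costs 5 and 2), then
`‖E₀(X, c)‖ ≤ A′ e^{2εe^{2κ}(2d+1)K₀c₁} K₀ e^{−κ d(X)}` with `ε = τ c₁ K₀ e^{−b}`. [cite: Balaban1988Convergent, (3.47) p.278] -/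
theorem norm_E0_window_le_of_decay {H H' : Dom B → ℂ} {a : Dom B → ℝ} (hKP : IsKPVolume (Touch B) H a Finset.univ)
    (c : Cell B) {A A' R R' r₁ b τ κ κ₂ : ℝ} (hA : 0 ≤ A) (hA' : 0 ≤ A') (hτ : 0 ≤ τ) (hr₁ : 0 ≤ r₁)
    (hb : r₁ * 5 ≤ b) (hκ : 0 ≤ κ)
    (hH : ∀ Z : Dom B, ‖H Z‖ ≤ A * Real.exp (-(R * treeLen Z.1)))
    (hH' : ∀ Z₀ : Dom B, ‖H' Z₀‖ ≤ A' * Real.exp (-(R' * treeLen Z₀.1)))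
    (hrate : r₁ + 2 * kappa₀ (4 * 2 ^ d) (2 * d) + 1 + τ * (4 * 2 ^ d) ≤ R)
    (hsmall : A * Real.exp (b + τ * (4 * 2 ^ d)) * K₀ (4 * 2 ^ d) (2 * d) * (2 * (d : ℝ) + 1) ≤ τ)
    (hε1 : τ * (4 * 2 ^ d) * K₀ (4 * 2 ^ d) (2 * d) * Real.exp (-b) ≤ 1)
    (hrκ : kappa₀ (4 * 2 ^ d) (2 * d) ≤ r₁ - κ) (hκ₂ : kappa₀ (4 * 2 ^ d) (2 * d) ≤ κ₂)
    (hrate' : κ + 2 * (τ * (4 * 2 ^ d) * K₀ (4 * 2 ^ d) (2 * d) * Real.exp (-b)) * Real.exp (κ * 2) *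
        ((2 * (d : ℝ) + 1) * K₀ (4 * 2 ^ d) (2 * d)) * (4 * 2 ^ d) + κ₂ ≤ R')
    (X : Finset (Cell B)) :
    ‖E0 (domsWith B c)
        (fun Z₀ => ((Finset.univ : Finset (Dom B)).powerset.image
          fun C => C.biUnion fun X => cellsOf B X.1).filter (TouchesCells B Z₀))
        (fun Z : Dom B => cellsOf B Z.1) H' (locE (Touch B) (fun Z : Dom B => cellsOf B Z.1) H) X‖ ≤
      A' * Real.exp (2 * (τ * (4 * 2 ^ d) * K₀ (4 * 2 ^ d) (2 * d) * Real.exp (-b)) * Real.exp (κ * 2) *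
          ((2 * (d : ℝ) + 1) * K₀ (4 * 2 ^ d) (2 * d)) * (4 * 2 ^ d)) *
        K₀ (4 * 2 ^ d) (2 * d) * Real.exp (-(κ * dW B X)) :=
  norm_E0_window_le B hKP c hA'
    (mul_nonneg (mul_nonneg (mul_nonneg hτ (by positivity)) (K₀_pos _ _).le) (Real.exp_nonneg _)) hε1 hκ hr₁
    hrκ hκ₂ hH' (fun _ hY => norm_locE_window_le B hA hτ hr₁ hb hH hrate hsmall hY) hrate' X

end WindowBound347

end Literature.MathematicalPhysics.QuantumFieldTheory.Balaban1983to89.B14Eq344PolymerRatio
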